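/-
Copyright: statement-level skeleton of a published paper (lit-balaban cell, reader/typer r15). No proof claims beyond
what the kernel checks below.
-/
import Literature.MathematicalPhysics.QuantumFieldTheory.Balaban1983to89.B3Sect3ScalarSelfEnergy

/-!
# B3 — T. Bałaban, *(Higgs)₂,₃ quantum fields in a finite volume. III. Renormalization*, CMP **88** (1983) 411–445
[Balaban1983Higgs3], Sect. 3 pp. 439–442: the self-energy graphs for vector fields, (3.25)–(3.32)

statement-level skeleton of published theorems with citation tags; proofs where landed; nothing here is a claim about
the Yang–Mills mass gap

Source: held text `paper:balaban1983-higgs-2-3-quantum-fields-finite-volume` (journal page = PDF page + 410); renders of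
pp. 439–442 read as images (`run/shared/lean/pub/pub-balaban/b2b-balaban-ref1/pages/1983-cmp88-higgs23-III/…-p029…p032-x2.png`,
strip crops of pp. 440–441).  Row **B3.Eq3.25-3.32** of `HOME/lit-balaban-r15/ROWS-B3.md` (reader/typer r15, fold owner of B3);
§6 also types the momentum-space evaluation **(3.24)** p. 439 of row B3.Eq3.21-3.24.  CARRIERS as in the sibling file
`B3Sect3ScalarSelfEnergy` ((3.9)/(3.11)): the tori `Site P j`, `SiteField`, the linear lattice calculus `LatticeFieldCalculus`
(`pdiff` = ∂^η_μ, `pdiffAdj` = ∂^{η*}_μ), two-point kernels `Kernel P j` with their integral operators `kernelOp` (volume element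
η^d); the external VECTOR legs A, A′ are bond fields `VecField P j ℝ` read as A_μ(x) = A ⟨x, μ⟩; tr q² is carried as the real
number `τ`.  §6 ((3.24), (3.27), (3.28)) is stated on the infinite ξ-lattice ξℤ^d (sites `Fin d → ℤ`) with the free
propagator C^ξ = (−Δ^ξ + 1)^{−1} given by its momentum integral, as printed.

THE PRINTED TEXT (verbatim, pp. 439–442).  p. 439 [PDF 29]: *"The next class of graphs is the class of self-energy graphs for
vector fields. The graphs of lowest order are [four pictures] (D = −d + 2), (3.25) and they form a renormalized class of graphs
connected by Ward-Takahashi identities (2.26) and (2.27). Let us analyze in detail the expressions corresponding to these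
graphs."*  p. 440 [PDF 30]: *"Applying the same transformations as for (3.9), we get
− Σ_{x,x′} η^{2d} Σ_{μ,μ′=1}^d g(x)A_μ(x) tr q²(G^η_{(j)}(0)∂^{η*}_{μ′})(x,x′)(G^η_{(j′)}(0)∂^{η*}_μ)(x′,x) g′(x′)A′_{μ′}(x′)
+ Σ_{x,x′} η^{2d} Σ_{μ,μ′=1}^d g(x)A_μ(x) tr q² G^η_{(j)}(0;x,x′)(∂^η_{μ′}G^η_{(j′)}(0)∂^{η*}_μ)(x′,x) g′(x′)A′_{μ′}(x′)
− Σ_x η^d Σ_{μ=1}^d g(x)A_μ(x)g′(x)A′_μ(x) tr q² G^η_{(j″)}(0,x,x) − Σ_x η^d Σ_{μ=1}^d g(x)A_μ(x)g′(x)A′_μ(x) tr q² η(G^η_{(j″)}(0)∂^{η*}_μ)(x,x)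
= −[ Σ_{x,x′} η^{2d} Σ_{μ,μ′} g(x)A_μ(x) tr q²(G^η_{(j)}(0)∂^{η*}_{μ′})(x,x′)(G^η_{(j′)}(0)∂^{η*}_μ)(x′,x) g′(x)A_{μ′}(x)
+ Σ_{x,x′} η^{2d} Σ_{μ,μ′} g(x)A_μ(x) tr q² G^η_{(j)}(0;x,x′)(∂^η_{μ′}G^η_{(j′)}(0)∂^{η*}_μ)(x′,x) g′(x)A_{μ′}(x)
− Σ_x η^d Σ_μ g(x)A_μ(x)g′(x)A′_μ(x) tr q² G^η_{(j″)}(0;x,x) − Σ_x η^d Σ_μ g(x)A_μ(x)g′(x)A′_μ(x) tr q² η(G^η_{(j″)}(0)∂^{η*}_μ)(x,x) ]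
+ { Σ_{ν=1}^d Σ_{x,x′} η^{2d} Σ_{μ,μ′} g(x)A_μ(x)·tr q²[−(G^η_{(j)}(0)∂^{η*}_{μ′})(x,x′)(G^η_{(j′)}(0)∂^{η*}_μ)(x′,x)(x′_ν − x_ν)
+ G^η_{(j)}(0;x,x′)(∂^η_{μ′}G^η_{(j′)}(0)∂^{η*}_μ)(x′,x)(x′_ν − x_ν)](∂^η_ν g′A′_{μ′})(x) }
+ { Σ_{x,x′} η^{2d} Σ_{μ,μ′} g(x)A_μ(x) tr q²[−(G^η_{(j)}(0)∂^{η*}_{μ′})(x,x′)(G^η_{(j′)}(0)∂^{η*}_μ)(x′,x)|x′−x|^{1+α}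
+ G^η_{(j)}(0;x,x′)(∂^η_{μ′}G^η_{(j′)}(0)∂^{η*}_μ)(x′,x)|x′−x|^{1+α}]·Σ_{b⊂Γ_{x,x′}} (η|b_−−x|^α/|x′−x|^{1+α})
((∂^ηg′A′_{μ′})(b) − (∂^ηg′A′_{μ′})((b)_x))/|b_−−x|^α }, (3.26)
where A, A′ are external vector field legs. The expressions in the last curly bracket above are the generalized expressions of
the same form as in (3.11), they have positive degree −d+3+α and can be analyzed as in (3.13), (3.14), and Proposition 2.2 can
be applied. The remaining expressions are analyzed in the same way as the first term in (3.11). If j₀ denotes a smallest j-index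
of external legs, then we sum with respect to j, j′, j″ from 0 to j₀ and we get the same expressions but with the propagator
G^η_{j₀}(0). The expression in the square bracket on the right side of (3.26) has the form Σ_x η^d Σ_{μ,μ′=1}^d g(x)A_μ(x)
Π^{(η,j₀)}_{μμ′}(x)g′(x)A′_{μ′}(x),"*  p. 441 [PDF 31]: *"graphically it is [picture], and the expression in the first curly
bracket has the form Σ_{ν=1}^d Σ_x η^d Σ_{μ,μ′=1}^d g(x)A_μ(x)Π^{(η,j₀)}_{μμ′ν}(x)(∂^η_νg′A′_{μ′})(x), graphically [picture]. Now
let us rescale the functions Π^{(η,j₀)}_{μμ′}, Π^{(η,j₀)}_{μμ′ν} from the η-lattice to the L^{−j₀}-lattice. We get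
Π^{(η,j₀)}_{μμ′}(x) = (L^{j₀}η)^{−d+2}Π^{(L^{−j₀},j₀)}_{μμ′}(y), Π^{(η,j₀)}_{μμ′ν}(x) = (L^{j₀}η)^{−d+3}Π^{(L^{−j₀},j₀)}_{μμ′ν}(y),
y = (L^{j₀}η)^{−1}x. We consider the case d = 3, so −d+2 = −1, −d+3 = 0. Next we replace the propagator G_{j₀}(0) by C^ξ,
ξ = L^{−j₀}, using the same equation as in (3.16). … For the expression Π^{(L^{−j₀},j₀)}_{μμ′ν}, we have to consider the term
tr q² Σ_{y′} ξ^d[−(C^ξ∂^{ξ*}_{μ′})(y−y′)(C^ξ∂^{ξ*}_μ)(y′−y)(y′_ν−y_ν) + C^ξ(y−y′)(∂^ξ_{μ′}C^ξ∂^{ξ*}_μ)(y′−y)(y′_ν−y_ν)] = …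
= ½ tr q² Σ_{y′} ξ^d(C^ξ(y′+ξe_μ) − C^ξ(y′−ξe_μ))(∂^ξ_{μ′}C^ξ)(y′)δ_{μν} − (μ↔μ′). (3.27) We have used the identities
C^ξ(−y′) = C^ξ(y′), (∂^ξ_μC^ξ)(−y′) = (∂^{ξ*}_μC^ξ)(y′) and the integration by parts formula. Furthermore, for the last expression
we have Σ_{y′} ξ^d(C^ξ(y′+ξe_μ) − C^ξ(y′−ξe_μ))(∂^ξ_{μ′}C^ξ)(y′) = 2(2π)^{−d}∫_{|p|≤π/ξ} dp ξ^{−1} sin ξp_μ sin ξp_{μ′}/(Δ^ξ(p)+1)²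
= (2/d)(2π)^{−d}∫_{|p′|≤π} dp′ (Σ_{μ=1}^d sin²p′_μ)/(Δ¹(p′)+ξ²)² ξ^{3−d}δ_{μμ′}, (3.28) which is symmetric in μ, μ′, hence finally
the term (3.27) is equal to 0. Let us consider the corresponding term coming from Π^{(L^{−j₀},j₀)}_{μμ′}, and let us rescale the
external legs A, A′ from the η-lattice to the ξ-lattice also. We get the expression (L^{j₁}η)^{−(d−2)/2}(L^{j₀}η)^{d−(d−2)/2}
[−Σ_{y,y′}ξ^{2d}Σ_{μ,μ′}g(y)A_μ(y) tr q²(C^ξ∂^{ξ*}_{μ′})(y−y′)(C^ξ∂^{ξ*}_μ)(y′−y)g′(y)A′_{μ′}(y) + Σ_{y,y′}ξ^{2d}Σ_{μ,μ′}g(y)A_μ(y)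
tr q²C^ξ(y−y′)(∂^ξ_{μ′}C^ξ∂^{ξ*}_μ)(y′−y)g′(y)A′_{μ′}(y) − Σ_yξ^dΣ_μ g(y)A_μ(y)g′(y)A′_{μ′}(y) tr q²C^ξ(0) − Σ_yξ^dΣ_μ
g(y)A_μ(y)g′(y)A′_{μ′}(y) tr q²(C^ξ∂^{ξ*}_μ)(0)]. (3.29)"*  p. 442 [PDF 32]: *"Now if we introduce the function λ(y′) =
Σ_{μ′=1}^d g′(y)A′_{μ′}(y)(y′_{μ′} − y_{μ′}), then (∂^ξ_{μ′}λ)(y′) = g′(y)A′_{μ′}(y), and the expression in the square bracket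
above has exactly the form appearing in the Ward-Takahashi identity (2.26) with M² = 1, hence it is equal to 0. … [pictures
(3.30)] … The other primitively divergent graphs are considered in a simpler way, because they have degree 0. We write
Σ_{x,x′}η^{2d}Σ_{μ,μ′=1}^d g(x)A_μ(x)Π_{μμ′}(x,x′)g′(x′)A′_{μ′}(x′) = Σ_{x,x′}η^{2d}Σ_{μ,μ′=1}^d g(x)A_μ(x)Π_{μμ′}(x,x′)|x′−x|^α
(g′(x′)A′_{μ′}(x′) − g′(x)A′_{μ′}(x))/|x′−x|^α + Σ_xη^dΣ_{μ,μ′=1}^d g(x)A_μ(x)(Σ_{x′}η^dΠ_{μμ′}(x,x′))g′(x)A′_{μ′}(x), (3.31) and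
the first term on the right side is convergent. … [pictures (3.32)]"*.

WHAT IS TYPED / PROVED.  §2: the kernels (G∂^{η*}_μ)(y,x′) (`dAdjKernel`) and (∂^η_{μ′}G∂^{η*}_μ)(x,x′) (`d2Kernel`), PROVED
to be the kernels of G ∘ ∂^{η*}_μ and ∂^η_{μ′} ∘ G ∘ ∂^{η*}_μ for the volume element η^d (`kernelOp_dAdjKernel`, `kernelOp_d2Kernel`;
`d2Kernel_diag`: μ′ = μ is the sibling's `dKernel` of (3.9)).  §3: **(3.26)** — the four terms of its left side as defs with
bodies (`kerA`, `kerB` = the two tr q²-kernels, `pairSum` = the generic two-leg pairing, `term3`, `term4`, `lhs326`), its square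
bracket `bracket326`, its two curly brackets `curly1`/`curly2`, and **`eq326` PROVED**: (3.26) is the rearrangement of its left
side under Taylor's formula (3.10) applied to the leg g′A′_{μ′}, which enters as the hypothesis `hT` in its printed shape
(exactly as `B3Sect3ScalarSelfEnergy.eq311` for (3.11)).  §4: the Π-forms of pp. 440–441 (`Pi2` = Π^{(η,j₀)}_{μμ′}(x),
`Pi3` = Π^{(η,j₀)}_{μμ′ν}(x), defs with bodies) with `bracket326_eq_Pi2` / `curly1_eq_Pi3` PROVED (the two sentences "has the
form …"), the p. 441 rescaling identities PROVED from the scaling of the free propagators G^η = (L^{j₀}η)^{−d+2}G^ξ and of the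
coordinate differences (`Pi2_rescale`, `Pi3_rescale`), and the d = 3 arithmetic (`exponents_d3`).  §5: **(3.29)** as a def with
body (`expr329` = prefactor · the bracket of (3.26) on the ξ-lattice with all propagators C^ξ; `expr329_eq_Pi2`).  §6: on ξℤ^d
(sites `ZSite d = Fin d → ℤ`, difference quotients `pdiffZ`/`pdiffAdjZ`) with the free propagator C^ξ given
by its momentum integral (`Cxi`): the two identities used for (3.27) PROVED (`Cxi_neg`: C^ξ is even; `pdiffZ_neg_of_even` /
`pdiffZ_Cxi_neg`: (∂^ξ_μC)(−y′) = (∂^{ξ*}_μC)(y′) for every even kernel), **(3.27)**, **(3.28)** and **(3.24)** typed as `Prop`s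
(`Eq327`, `Eq328`, `Eq324`; lattice sums as `tsum`, momentum integrals over the Brillouin box), the printed inference "symmetric
in μ, μ′, hence (3.27) is equal to 0" PROVED in the form used (`rhs327_eq_zero_of_diag`, `lhs327_eq_zero`; T6), and the p. 442
λ-sentence PROVED (`pdiffZ_lambda442`).  §7: **(3.31)** PROVED (`eq331`, with |x′ − x| the sup torus distance in units of η;
the generic form `eq331_of_weight` for any weight vanishing only on the diagonal).

TRANSCRIPT NOTES (for the referees).  T1 (**sign placement in (3.26)**, REPAIRED): print opens the square bracket as
"= −[T₁′ + T₂′ − T₃ − T₄]" (Tᵢ′ = the i-th term of the left side with the leg g′A′ localized at x); the identity holds — and is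
PROVED here — with the bracket read as [−T₁′ + T₂′ − T₃ − T₄] + {…} + {…}, i.e. the exterior minus belongs to the first term
only; this is also how the paper itself re-prints the bracket in (3.29) ("[−Σ … + Σ … − Σ … − Σ …]").  T2: in the bracket of
(3.26) print has "g′(x)A_{μ′}(x)" twice (prime on A′ dropped) and on the left side "G^η_{(j″)}(0, x, x)" for G^η_{(j″)}(0; x, x);
in (3.29) the last two terms print A′_{μ′}(y) under Σ_μ alone (typed A′_μ, as in (3.26)) and the last term prints tr q²(C^ξ∂^{ξ*}_μ)(0)
without the factor ξ that (3.26) carries as η (v1.1 erratum to this note: the ∂^{ξ*} there carries μ, not μ′).  T3: as in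
`eq311`, the coordinate differences (x′_ν − x_ν) along Γ_{x,x′}, the derivative leg (∂^η_νg′A′_{μ′})(x) and the remainder of
(3.10) are supplied data (`dx`, `D`, `R`) of `eq326`; the |x′−x|^{1+α} inserted and divided in the last curly bracket is not
performed there (it is performed, verbatim, in (3.31) `eq331`).  T4: Δ^ξ(p) in (3.24)/(3.28) is the (nonnegative) symbol
Σ_μ ξ^{−2}(2 − 2cos ξp_μ) of −Δ^ξ (C^ξ = (−Δ^ξ + 1)^{−1}, (3.16)); "|p| ≤ π/ξ" is read as the Brillouin box max_μ|p_μ| ≤ π/ξ;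
∂^ξ_μ(p) in (3.24) is the symbol ξ^{−1}(e^{iξp_μ} − 1) of ∂^ξ_μ, whose real part ξ^{−1}(cos ξp_μ − 1) is what survives in the
(real) integral — typed so.  T5: the infinite-lattice sums of §6 are `tsum`s (absolutely convergent for the exponentially
decaying C^ξ; not proved here).  T6: "which is symmetric in μ, μ′, hence finally the term (3.27) is equal to 0" — what the
vanishing of ½ tr q² S(μ,μ′)δ_{μν} − (μ↔μ′) uses is that (3.28) is DIAGONAL, S(μ,μ′) ∝ δ_{μμ′} (symmetry alone does not give 0:
S ≡ 1, μ = ν ≠ μ′); PROVED in that form.  NOT TYPED: the pictures (3.25), (3.30), (3.32), the intermediate (second) member of (3.27),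
the vanishing of the bracket of (3.29) (the paper's inference from the Ward–Takahashi identity (2.26), row B3.Eq2.26-2.28),
the convergence / degree claims.  NOTHING beyond the kernel-checked statements below is asserted.

v1.1 (append-only, r15 gen 3): §8 the ξ-rescaling p = p′/ξ of the momentum integrals PROVED — the SECOND equality of **(3.24)**
(`eq324_rescale`) and the rescaling step of (3.28) (`eq328_rescale`), via the Brillouin-box change of variables
`integral_bzBox_comp_smul` and Δ^ξ(p) = ξ^{−2}Δ¹(ξp) (`lapSymbol_eq_smul`); §9 the symmetry step of (3.28) PROVED — reflection
p′_μ ↦ −p′_μ kills μ ≠ μ′ (`integral328_offDiag`), coordinate transposition averages the diagonal (`integral328_diag_eq`,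
`integral328_symmetry`) — hence the SECOND equality of **(3.28)** in full (`eq328_second`), the diagonality of S(μ,μ′) under
(3.28) (`sum328_offDiag`) and "hence (3.27) = 0" from `Eq327` ∧ `Eq328` (`lhs327_eq_zero_of_eq328`); §10 the algebraic content
of **(3.27)** PROVED for every even, finitely supported kernel on ξℤ^d (`eq327_of_even_finsupp`: first member = last member,
via translation, the two p. 441 identities, pair sums and the first-moment identity; generic carriers `lhs327Of`/`sum328Of`
with `lhs327_eq_of`/`sum328_eq_of`).  Still typed only: the FIRST equalities of (3.24)/(3.28) (lattice sum = momentum integral,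
Plancherel on ξℤ^d) and (3.27) for C^ξ itself (T5: convergence bookkeeping for the infinitely supported C^ξ).
-/

open scoped BigOperators
open MeasureTheory

namespace Literature.MathematicalPhysics.QuantumFieldTheory.Balaban1983to89.B3Sect3VectorSelfEnergy

open LatticeFieldCalculus B3Sect3ScalarSelfEnergy

noncomputable section

/-! ## 1. Torus bookkeeping (helpers) -/

section Helpers

variable {P : Params} {j : ℕ}

/-- `(x − e_μ) + e_μ = x` on the torus. [folklore] -/
private theorem shift_unshift (x : Site P j) (μ : Fin P.d) : (x.unshift μ).shift μ = x :=
  (shiftEquiv (P := P) (j := j) μ).apply_symm_apply x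

/-- `(x + e_μ) − e_μ = x` on the torus. [folklore] -/
private theorem unshift_shift (x : Site P j) (μ : Fin P.d) : (x.shift μ).unshift μ = x :=
  (shiftEquiv (P := P) (j := j) μ).symm_apply_apply x

/-- Reindexing a site sum by the translation `x ↦ x + e_μ`: `Σ_x F(x + e_μ) = Σ_x F(x)`. [folklore] -/
private theorem sum_comp_shift {α : Type*} [AddCommMonoid α] (μ : Fin P.d) (F : Site P j → α) :
    ∑ x : Site P j, F (x.shift μ) = ∑ x : Site P j, F x :=
  Equiv.sum_comp (shiftEquiv (P := P) (j := j) μ) F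

/-- Pulling a constant through a double sum and moving a sum over directions inside:
`Σ_ν Σ_x Σ_{x′} c·Σ_μΣ_{μ′} T = Σ_x Σ_{x′} c·Σ_μΣ_{μ′}Σ_ν T`. [folklore] -/
private theorem sum_dir_outside (c : ℝ) (T : Fin P.d → Site P j → Site P j → Fin P.d → Fin P.d → ℝ) :
    ∑ ν : Fin P.d, ∑ x : Site P j, ∑ x' : Site P j, c * ∑ μ : Fin P.d, ∑ μ' : Fin P.d, T ν x x' μ μ' =
      ∑ x : Site P j, ∑ x' : Site P j, c * ∑ μ : Fin P.d, ∑ μ' : Fin P.d, ∑ ν : Fin P.d, T ν x x' μ μ' := by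
  rw [Finset.sum_comm]
  refine Finset.sum_congr rfl fun x _ => ?_
  rw [Finset.sum_comm]
  refine Finset.sum_congr rfl fun x' _ => ?_
  rw [← Finset.mul_sum]
  congr 1
  rw [Finset.sum_comm]
  refine Finset.sum_congr rfl fun μ _ => ?_
  rw [Finset.sum_comm]

end Helpers

/-! ## 2. The kernels of G ∘ ∂^{η*}_μ and ∂^η_{μ′} ∘ G ∘ ∂^{η*}_μ -/

section Kernels

variable {P : Params} {j : ℕ}

/-- The kernel (G∂^{η*}_μ)(y,x′) of (3.26): c(G(y,x′+e_μ) − G(y,x′)), c = η^{−1} (∂^{η*}_μ acting on the right produces a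
forward difference quotient in the second variable). [cite: Balaban1983Higgs3, (3.26) p.440] -/
def dAdjKernel (c : ℝ) (μ : Fin P.d) (G : Kernel P j) : Kernel P j :=
  fun y x' => c * (G y (x'.shift μ) - G y x')

/-- kernel: `dAdjKernel` IS the kernel of G ∘ ∂^{η*}_μ: Σ_{x′} w(G∂^{η*}_μ)(y,x′)f(x′) = (G(∂^{η*}_μf))(y) (summation by parts on
the torus). [cite: Balaban1983Higgs3, (3.26) p.440] -/
theorem kernelOp_dAdjKernel (w c : ℝ) (μ : Fin P.d) (G : Kernel P j) (f : SiteField P j ℝ) :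
    kernelOp w (dAdjKernel c μ G) f = kernelOp w G (pdiffAdj c μ f) := by
  funext y
  simp only [kernelOp, dAdjKernel, pdiffAdj, smul_eq_mul]
  have hre : ∑ x' : Site P j, w * G y x' * (c * f (x'.unshift μ)) =
      ∑ x' : Site P j, w * G y (x'.shift μ) * (c * f x') := by
    rw [← sum_comp_shift μ (fun x' => w * G y x' * (c * f (x'.unshift μ)))]
    simp only [unshift_shift]
  calc ∑ x' : Site P j, w * (c * (G y (x'.shift μ) - G y x')) * f x'
      = ∑ x' : Site P j, w * G y (x'.shift μ) * (c * f x') - ∑ x' : Site P j, w * G y x' * (c * f x') := by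
        rw [← Finset.sum_sub_distrib]
        exact Finset.sum_congr rfl fun _ _ => by ring
    _ = ∑ x' : Site P j, w * G y x' * (c * f (x'.unshift μ)) - ∑ x' : Site P j, w * G y x' * (c * f x') := by rw [hre]
    _ = ∑ x' : Site P j, w * G y x' * (c * (f (x'.unshift μ) - f x')) := by
        rw [← Finset.sum_sub_distrib]
        exact Finset.sum_congr rfl fun _ _ => by ring

/-- The kernel (∂^η_{μ′}G∂^{η*}_μ)(x,x′) of (3.26): c²[G(x+e_{μ′},x′+e_μ) − G(x+e_{μ′},x′) − G(x,x′+e_μ) + G(x,x′)], c = η^{−1}.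
[cite: Balaban1983Higgs3, (3.26) p.440] -/
def d2Kernel (c : ℝ) (μ' μ : Fin P.d) (G : Kernel P j) : Kernel P j :=
  fun x x' => c ^ 2 * (G (x.shift μ') (x'.shift μ) - G (x.shift μ') x' - G x (x'.shift μ) + G x x')

/-- kernel: `d2Kernel` IS the kernel of ∂^η_{μ′} ∘ G ∘ ∂^{η*}_μ: Σ_{x′} w(∂^η_{μ′}G∂^{η*}_μ)(x,x′)f(x′) = (∂^η_{μ′}(G(∂^{η*}_μf)))(x).
[cite: Balaban1983Higgs3, (3.26) p.440] -/
theorem kernelOp_d2Kernel (w c : ℝ) (μ' μ : Fin P.d) (G : Kernel P j) (f : SiteField P j ℝ) :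
    kernelOp w (d2Kernel c μ' μ G) f = pdiff c μ' (kernelOp w G (pdiffAdj c μ f)) := by
  rw [← kernelOp_dAdjKernel]
  funext x
  simp only [pdiff, kernelOp, dAdjKernel, d2Kernel, smul_eq_mul, mul_sub, Finset.mul_sum, ← Finset.sum_sub_distrib]
  exact Finset.sum_congr rfl fun _ _ => by ring

/-- kernel: on the diagonal μ′ = μ the kernel (∂^η_μG∂^{η*}_μ)(x,x′) is the sibling's `dKernel` of (3.9). [cite: Balaban1983Higgs3, (3.26) p.440] -/
theorem d2Kernel_diag (c : ℝ) (μ : Fin P.d) (G : Kernel P j) : d2Kernel c μ μ G = dKernel c μ G := rfl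

end Kernels

/-! ## 3. (3.26): the four vector self-energy graphs and their Taylor rearrangement -/

section Eq326

variable {P : Params} {j : ℕ}

/-- The kernel of the first graph of (3.26): tr q²(G^η_{(j)}(0)∂^{η*}_{μ′})(x,x′)(G^η_{(j′)}(0)∂^{η*}_μ)(x′,x) (`τ` = tr q²,
`Gj` = G^η_{(j)}(0), `Gj'` = G^η_{(j′)}(0)). [cite: Balaban1983Higgs3, (3.26) p.440] -/
def kerA (η τ : ℝ) (Gj Gj' : Kernel P j) (μ μ' : Fin P.d) : Kernel P j :=
  fun x x' => τ * (dAdjKernel η⁻¹ μ' Gj x x' * dAdjKernel η⁻¹ μ Gj' x' x)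

/-- The kernel of the second graph of (3.26): tr q² G^η_{(j)}(0;x,x′)(∂^η_{μ′}G^η_{(j′)}(0)∂^{η*}_μ)(x′,x).
[cite: Balaban1983Higgs3, (3.26) p.440] -/
def kerB (η τ : ℝ) (Gj Gj' : Kernel P j) (μ μ' : Fin P.d) : Kernel P j :=
  fun x x' => τ * (Gj x x' * d2Kernel η⁻¹ μ' μ Gj' x' x)

/-- The combined kernel of the curly brackets of (3.26): tr q²[−(G^η_{(j)}(0)∂^{η*}_{μ′})(x,x′)(G^η_{(j′)}(0)∂^{η*}_μ)(x′,x)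
+ G^η_{(j)}(0;x,x′)(∂^η_{μ′}G^η_{(j′)}(0)∂^{η*}_μ)(x′,x)]. [cite: Balaban1983Higgs3, (3.26) p.440] -/
def kerC (η τ : ℝ) (Gj Gj' : Kernel P j) (μ μ' : Fin P.d) : Kernel P j :=
  fun x x' => -kerA η τ Gj Gj' μ μ' x x' + kerB η τ Gj Gj' μ μ' x x'

/-- The generic two-leg pairing of (3.26): Σ_{x,x′} η^{2d} Σ_{μ,μ′=1}^d g(x)A_μ(x)·K_{μμ′}(x,x′)·F_{μ′}(x,x′), the vector leg
gA at x and a second leg F read at (x,x′) (F_{μ′}(x,x′) = g′(x′)A′_{μ′}(x′) on the left side of (3.26), g′(x)A′_{μ′}(x) in its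
square bracket, (x′_ν − x_ν)(∂^η_νg′A′_{μ′})(x) resp. the Taylor remainder in its curly brackets); A_μ(x) = A ⟨x, μ⟩.
[cite: Balaban1983Higgs3, (3.26) p.440] -/
def pairSum (η : ℝ) (K : Fin P.d → Fin P.d → Kernel P j) (g : SiteField P j ℝ) (A : VecField P j ℝ)
    (F : Fin P.d → Site P j → Site P j → ℝ) : ℝ :=
  ∑ x : Site P j, ∑ x' : Site P j, η ^ (2 * P.d) *
    ∑ μ : Fin P.d, ∑ μ' : Fin P.d, g x * A ⟨x, μ⟩ * K μ μ' x x' * F μ' x x'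

/-- The nonlocal scalar-leg reading F_{μ′}(x,x′) = g′(x′)A′_{μ′}(x′) (left side of (3.26)). [cite: Balaban1983Higgs3, (3.26) p.440] -/
def legFar (g' : SiteField P j ℝ) (A' : VecField P j ℝ) : Fin P.d → Site P j → Site P j → ℝ :=
  fun μ' _ x' => g' x' * A' ⟨x', μ'⟩

/-- The localized reading F_{μ′}(x,x′) = g′(x)A′_{μ′}(x) (square bracket of (3.26)). [cite: Balaban1983Higgs3, (3.26) p.440] -/
def legNear (g' : SiteField P j ℝ) (A' : VecField P j ℝ) : Fin P.d → Site P j → Site P j → ℝ :=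
  fun μ' x _ => g' x * A' ⟨x, μ'⟩

/-- The third term of (3.26) without its sign: Σ_x η^d Σ_{μ=1}^d g(x)A_μ(x)g′(x)A′_μ(x) tr q² G^η_{(j″)}(0;x,x) (`Gj''` =
G^η_{(j″)}(0); T2). [cite: Balaban1983Higgs3, (3.26) p.440] -/
def term3 (η τ : ℝ) (Gj'' : Kernel P j) (g g' : SiteField P j ℝ) (A A' : VecField P j ℝ) : ℝ :=
  ∑ x : Site P j, η ^ P.d * ∑ μ : Fin P.d, g x * A ⟨x, μ⟩ * g' x * A' ⟨x, μ⟩ * (τ * Gj'' x x)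

/-- The fourth term of (3.26) without its sign: Σ_x η^d Σ_{μ=1}^d g(x)A_μ(x)g′(x)A′_μ(x) tr q² η(G^η_{(j″)}(0)∂^{η*}_μ)(x,x).
[cite: Balaban1983Higgs3, (3.26) p.440] -/
def term4 (η τ : ℝ) (Gj'' : Kernel P j) (g g' : SiteField P j ℝ) (A A' : VecField P j ℝ) : ℝ :=
  ∑ x : Site P j, η ^ P.d * ∑ μ : Fin P.d, g x * A ⟨x, μ⟩ * g' x * A' ⟨x, μ⟩ * (τ * (η * dAdjKernel η⁻¹ μ Gj'' x x))

/-- **(3.26)** p. 440 [PDF 30], LEFT SIDE (verbatim in the module docstring): −T₁ + T₂ − T₃ − T₄ with T₁, T₂ the two nonlocal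
graphs (kernels `kerA`, `kerB`, leg g′(x′)A′_{μ′}(x′)) and T₃, T₄ the two local ones. [cite: Balaban1983Higgs3, (3.26) p.440] -/
def lhs326 (η τ : ℝ) (Gj Gj' Gj'' : Kernel P j) (g g' : SiteField P j ℝ) (A A' : VecField P j ℝ) : ℝ :=
  -pairSum η (kerA η τ Gj Gj') g A (legFar g' A') + pairSum η (kerB η τ Gj Gj') g A (legFar g' A')
    - term3 η τ Gj'' g g' A A' - term4 η τ Gj'' g g' A A'

/-- **(3.26)** p. 440, the SQUARE BRACKET of the right side: the four terms with the leg g′A′_{μ′} localized at x, read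
[−T₁′ + T₂′ − T₃ − T₄] (T1: print places the minus outside, "−[T₁′ + T₂′ − T₃ − T₄]"; (3.29) re-prints it as here).
[cite: Balaban1983Higgs3, (3.26) p.440] -/
def bracket326 (η τ : ℝ) (Gj Gj' Gj'' : Kernel P j) (g g' : SiteField P j ℝ) (A A' : VecField P j ℝ) : ℝ :=
  -pairSum η (kerA η τ Gj Gj') g A (legNear g' A') + pairSum η (kerB η τ Gj Gj') g A (legNear g' A')
    - term3 η τ Gj'' g g' A A' - term4 η τ Gj'' g g' A A'

/-- **(3.26)** p. 440, the FIRST CURLY BRACKET: Σ_{ν=1}^d Σ_{x,x′} η^{2d} Σ_{μ,μ′} g(x)A_μ(x)·tr q²[−(…)(x′_ν − x_ν) + (…)(x′_ν − x_ν)]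
(∂^η_νg′A′_{μ′})(x), with `dx ν x x′` = x′_ν − x_ν (along Γ_{x,x′}) and `D ν μ′` = ∂^η_ν(g′A′_{μ′}) (T3).
[cite: Balaban1983Higgs3, (3.26) p.440] -/
def curly1 (η τ : ℝ) (Gj Gj' : Kernel P j) (g : SiteField P j ℝ) (A : VecField P j ℝ)
    (dx : Fin P.d → Site P j → Site P j → ℝ) (D : Fin P.d → Fin P.d → SiteField P j ℝ) : ℝ :=
  ∑ ν : Fin P.d, pairSum η (fun μ μ' x x' => kerC η τ Gj Gj' μ μ' x x' * dx ν x x') g A (fun μ' x _ => D ν μ' x)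

/-- **(3.26)** p. 440, the LAST CURLY BRACKET: Σ_{x,x′} η^{2d} Σ_{μ,μ′} g(x)A_μ(x) tr q²[−(…) + (…)]·R_{μ′}(x,x′), `R μ′ x x′` = the
remainder Σ_{b⊂Γ_{x,x′}} η((∂^ηg′A′_{μ′})(b) − (∂^ηg′A′_{μ′})((b)_x)) of Taylor's formula (3.10) (T3: the printed |x′−x|^{1+α}
inserted and divided is not performed). [cite: Balaban1983Higgs3, (3.26) p.440] -/
def curly2 (η τ : ℝ) (Gj Gj' : Kernel P j) (g : SiteField P j ℝ) (A : VecField P j ℝ)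
    (R : Fin P.d → Site P j → Site P j → ℝ) : ℝ :=
  pairSum η (kerC η τ Gj Gj') g A R

/-- kernel: the pairing is additive in the second leg. [cite: Balaban1983Higgs3, (3.26) p.440] -/
theorem pairSum_add_leg (η : ℝ) (K : Fin P.d → Fin P.d → Kernel P j) (g : SiteField P j ℝ) (A : VecField P j ℝ)
    (F F' : Fin P.d → Site P j → Site P j → ℝ) :
    pairSum η K g A (fun μ' x x' => F μ' x x' + F' μ' x x') = pairSum η K g A F + pairSum η K g A F' := by
  simp only [pairSum, mul_add, Finset.sum_add_distrib]

/-- kernel: the pairing of a sum of legs over directions ν is the sum of the pairings. [cite: Balaban1983Higgs3, (3.26) p.440] -/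
theorem pairSum_sum_leg (η : ℝ) (K : Fin P.d → Fin P.d → Kernel P j) (g : SiteField P j ℝ) (A : VecField P j ℝ)
    (F : Fin P.d → Fin P.d → Site P j → Site P j → ℝ) :
    pairSum η K g A (fun μ' x x' => ∑ ν : Fin P.d, F ν μ' x x') = ∑ ν : Fin P.d, pairSum η K g A (F ν) := by
  simp only [pairSum]
  rw [sum_dir_outside]
  refine Finset.sum_congr rfl fun x _ => Finset.sum_congr rfl fun x' _ => ?_
  congr 1
  refine Finset.sum_congr rfl fun μ _ => Finset.sum_congr rfl fun μ' _ => ?_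
  rw [Finset.mul_sum]

/-- kernel: the pairing with the combined kernel is −(pairing with `kerA`) + (pairing with `kerB`). [cite: Balaban1983Higgs3, (3.26) p.440] -/
theorem pairSum_kerC (η τ : ℝ) (Gj Gj' : Kernel P j) (g : SiteField P j ℝ) (A : VecField P j ℝ)
    (F : Fin P.d → Site P j → Site P j → ℝ) :
    pairSum η (kerC η τ Gj Gj') g A F = -pairSum η (kerA η τ Gj Gj') g A F + pairSum η (kerB η τ Gj Gj') g A F := by
  simp only [pairSum, kerC, neg_add_eq_sub, ← Finset.sum_sub_distrib, ← mul_sub]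
  refine Finset.sum_congr rfl fun x _ => Finset.sum_congr rfl fun x' _ => ?_
  congr 1
  refine Finset.sum_congr rfl fun μ _ => Finset.sum_congr rfl fun μ' _ => ?_
  ring

/-- **(3.26)** p. 440 [PDF 30] — PROVED as the rearrangement of its left side under Taylor's formula (3.10) applied to the leg
g′A′_{μ′}: the hypothesis `hT` is (3.10) in its printed shape, g′(x′)A′_{μ′}(x′) = g′(x)A′_{μ′}(x) + Σ_ν(x′_ν − x_ν)(∂^η_νg′A′_{μ′})(x)
+ R_{μ′}(x,x′) (row B3.Eq3.10); conclusion: (left side) = [square bracket] + {first curly bracket} + {last curly bracket}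
(T1: bracket read [−T₁′ + T₂′ − T₃ − T₄]; T3). [cite: Balaban1983Higgs3, (3.26) p.440] -/
theorem eq326 (η τ : ℝ) (Gj Gj' Gj'' : Kernel P j) (g g' : SiteField P j ℝ) (A A' : VecField P j ℝ)
    (dx : Fin P.d → Site P j → Site P j → ℝ) (D : Fin P.d → Fin P.d → SiteField P j ℝ)
    (R : Fin P.d → Site P j → Site P j → ℝ)
    (hT : ∀ (μ' : Fin P.d) (x x' : Site P j),
      g' x' * A' ⟨x', μ'⟩ = g' x * A' ⟨x, μ'⟩ + (∑ ν : Fin P.d, dx ν x x' * D ν μ' x) + R μ' x x') :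
    lhs326 η τ Gj Gj' Gj'' g g' A A' =
      bracket326 η τ Gj Gj' Gj'' g g' A A' + curly1 η τ Gj Gj' g A dx D + curly2 η τ Gj Gj' g A R := by
  -- the leg decomposition as an identity of leg functions
  have hleg : legFar g' A' = fun μ' x x' =>
      (legNear g' A' μ' x x' + ∑ ν : Fin P.d, dx ν x x' * D ν μ' x) + R μ' x x' := by
    funext μ' x x'
    simp only [legFar, legNear]
    exact hT μ' x x'
  -- −T₁ + T₂ = pairing with the combined kernel; split the leg
  have hsplit : pairSum η (kerC η τ Gj Gj') g A (legFar g' A') =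
      pairSum η (kerC η τ Gj Gj') g A (legNear g' A') +
        pairSum η (kerC η τ Gj Gj') g A (fun μ' x x' => ∑ ν : Fin P.d, dx ν x x' * D ν μ' x) +
        pairSum η (kerC η τ Gj Gj') g A R := by
    rw [hleg, pairSum_add_leg, pairSum_add_leg]
  -- the Taylor part is the first curly bracket
  have hcurly1 : pairSum η (kerC η τ Gj Gj') g A (fun μ' x x' => ∑ ν : Fin P.d, dx ν x x' * D ν μ' x) =
      curly1 η τ Gj Gj' g A dx D := by
    rw [pairSum_sum_leg, curly1]
    refine Finset.sum_congr rfl fun ν _ => ?_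
    simp only [pairSum]
    refine Finset.sum_congr rfl fun x _ => Finset.sum_congr rfl fun x' _ => ?_
    congr 1
    refine Finset.sum_congr rfl fun μ _ => Finset.sum_congr rfl fun μ' _ => ?_
    ring
  have hL : lhs326 η τ Gj Gj' Gj'' g g' A A' =
      pairSum η (kerC η τ Gj Gj') g A (legFar g' A') - term3 η τ Gj'' g g' A A' - term4 η τ Gj'' g g' A A' := by
    rw [lhs326, pairSum_kerC]
  have hB : bracket326 η τ Gj Gj' Gj'' g g' A A' =
      pairSum η (kerC η τ Gj Gj') g A (legNear g' A') - term3 η τ Gj'' g g' A A' - term4 η τ Gj'' g g' A A' := by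
    rw [bracket326, pairSum_kerC]
  rw [hL, hB, hsplit, hcurly1, curly2]
  ring

end Eq326

/-! ## 4. The Π-forms of pp. 440–441 and their rescaling to the L^{−j₀}-lattice -/

section PiForms

variable {P : Params} {j : ℕ}

/-- kernel: a pairing whose second leg is read at x only collapses its x′-sum onto the kernel:
Σ_{x,x′}η^{2d}Σ_{μμ′} gA_μ(x)K_{μμ′}(x,x′)F_{μ′}(x) = Σ_xη^dΣ_{μμ′} gA_μ(x)(Σ_{x′}η^dK_{μμ′}(x,x′))F_{μ′}(x). [cite: Balaban1983Higgs3, (3.26) p.440] -/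
theorem pairSum_local (η : ℝ) (K : Fin P.d → Fin P.d → Kernel P j) (g : SiteField P j ℝ) (A : VecField P j ℝ)
    (Fl : Fin P.d → SiteField P j ℝ) :
    pairSum η K g A (fun μ' x _ => Fl μ' x) =
      ∑ x : Site P j, η ^ P.d * ∑ μ : Fin P.d, ∑ μ' : Fin P.d,
        g x * A ⟨x, μ⟩ * (∑ x' : Site P j, η ^ P.d * K μ μ' x x') * Fl μ' x := by
  simp only [pairSum, Finset.mul_sum, Finset.sum_mul]
  refine Finset.sum_congr rfl fun x _ => ?_
  rw [Finset.sum_comm]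
  refine Finset.sum_congr rfl fun μ _ => ?_
  rw [Finset.sum_comm]
  refine Finset.sum_congr rfl fun μ' _ => Finset.sum_congr rfl fun x' _ => ?_
  rw [two_mul, pow_add]
  ring

/-- **Π^{(η,j₀)}_{μμ′}(x)** p. 440 [PDF 30], defined by *"The expression in the square bracket on the right side of (3.26) has
the form Σ_x η^d Σ_{μ,μ′=1}^d g(x)A_μ(x)Π^{(η,j₀)}_{μμ′}(x)g′(x)A′_{μ′}(x)"*: Π_{μμ′}(x) = Σ_{x′}η^d tr q²[−(G∂^{η*}_{μ′})(x,x′)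
(G∂^{η*}_μ)(x′,x) + G(0;x,x′)(∂^η_{μ′}G∂^{η*}_μ)(x′,x)] − δ_{μμ′} tr q² G(0;x,x) − δ_{μμ′} tr q² η(G∂^{η*}_μ)(x,x) (after the
resummation all propagators are G^η_{j₀}(0); typed with the three kernel slots of (3.26)). [cite: Balaban1983Higgs3, (3.26) p.440] -/
def Pi2 (η τ : ℝ) (Gj Gj' Gj'' : Kernel P j) (μ μ' : Fin P.d) (x : Site P j) : ℝ :=
  (∑ x' : Site P j, η ^ P.d * kerC η τ Gj Gj' μ μ' x x')
    - (if μ = μ' then τ * Gj'' x x else 0) - (if μ = μ' then τ * (η * dAdjKernel η⁻¹ μ Gj'' x x) else 0)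

/-- p. 440 [PDF 30], PROVED: *"The expression in the square bracket on the right side of (3.26) has the form
Σ_x η^d Σ_{μ,μ′=1}^d g(x)A_μ(x)Π^{(η,j₀)}_{μμ′}(x)g′(x)A′_{μ′}(x)"* (with `Pi2`). [cite: Balaban1983Higgs3, (3.26) p.440] -/
theorem bracket326_eq_Pi2 (η τ : ℝ) (Gj Gj' Gj'' : Kernel P j) (g g' : SiteField P j ℝ) (A A' : VecField P j ℝ) :
    bracket326 η τ Gj Gj' Gj'' g g' A A' =
      ∑ x : Site P j, η ^ P.d * ∑ μ : Fin P.d, ∑ μ' : Fin P.d,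
        g x * A ⟨x, μ⟩ * Pi2 η τ Gj Gj' Gj'' μ μ' x * (g' x * A' ⟨x, μ'⟩) := by
  have hB : bracket326 η τ Gj Gj' Gj'' g g' A A' =
      pairSum η (kerC η τ Gj Gj') g A (legNear g' A') - term3 η τ Gj'' g g' A A' - term4 η τ Gj'' g g' A A' := by
    rw [bracket326, pairSum_kerC]
  have h1 : pairSum η (kerC η τ Gj Gj') g A (legNear g' A') =
      ∑ x : Site P j, η ^ P.d * ∑ μ : Fin P.d, ∑ μ' : Fin P.d,
        g x * A ⟨x, μ⟩ * (∑ x' : Site P j, η ^ P.d * kerC η τ Gj Gj' μ μ' x x') * (g' x * A' ⟨x, μ'⟩) :=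
    pairSum_local η (kerC η τ Gj Gj') g A (fun μ' x => g' x * A' ⟨x, μ'⟩)
  have h3 : term3 η τ Gj'' g g' A A' =
      ∑ x : Site P j, η ^ P.d * ∑ μ : Fin P.d, ∑ μ' : Fin P.d,
        g x * A ⟨x, μ⟩ * (if μ = μ' then τ * Gj'' x x else 0) * (g' x * A' ⟨x, μ'⟩) := by
    simp only [term3, mul_ite, ite_mul, zero_mul, mul_zero, Finset.sum_ite_eq, Finset.mem_univ, if_true]
    refine Finset.sum_congr rfl fun x _ => ?_
    congr 1
    exact Finset.sum_congr rfl fun μ _ => by ring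
  have h4 : term4 η τ Gj'' g g' A A' =
      ∑ x : Site P j, η ^ P.d * ∑ μ : Fin P.d, ∑ μ' : Fin P.d,
        g x * A ⟨x, μ⟩ * (if μ = μ' then τ * (η * dAdjKernel η⁻¹ μ Gj'' x x) else 0) * (g' x * A' ⟨x, μ'⟩) := by
    simp only [term4, mul_ite, ite_mul, zero_mul, mul_zero, Finset.sum_ite_eq, Finset.mem_univ, if_true]
    refine Finset.sum_congr rfl fun x _ => ?_
    congr 1
    exact Finset.sum_congr rfl fun μ _ => by ring
  rw [hB, h1, h3, h4]
  simp only [Pi2, mul_sub, sub_mul, Finset.sum_sub_distrib]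

/-- **Π^{(η,j₀)}_{μμ′ν}(x)** p. 441 [PDF 31], defined by *"the expression in the first curly bracket has the form
Σ_{ν=1}^d Σ_x η^d Σ_{μ,μ′=1}^d g(x)A_μ(x)Π^{(η,j₀)}_{μμ′ν}(x)(∂^η_νg′A′_{μ′})(x)"*: Π_{μμ′ν}(x) = Σ_{x′}η^d tr q²[−(…)(x,x′)(…)(x′,x)
+ G(0;x,x′)(∂^η_{μ′}G∂^{η*}_μ)(x′,x)](x′_ν − x_ν) (`dx ν x x′` = x′_ν − x_ν). [cite: Balaban1983Higgs3, (3.26) p.441] -/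
def Pi3 (η τ : ℝ) (Gj Gj' : Kernel P j) (dx : Fin P.d → Site P j → Site P j → ℝ) (μ μ' ν : Fin P.d) (x : Site P j) : ℝ :=
  ∑ x' : Site P j, η ^ P.d * (kerC η τ Gj Gj' μ μ' x x' * dx ν x x')

/-- p. 441 [PDF 31], PROVED: *"the expression in the first curly bracket has the form Σ_{ν=1}^d Σ_x η^d Σ_{μ,μ′=1}^d g(x)A_μ(x)
Π^{(η,j₀)}_{μμ′ν}(x)(∂^η_νg′A′_{μ′})(x)"* (with `Pi3`; `D ν μ′` = ∂^η_ν(g′A′_{μ′})). [cite: Balaban1983Higgs3, (3.26) p.441] -/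
theorem curly1_eq_Pi3 (η τ : ℝ) (Gj Gj' : Kernel P j) (g : SiteField P j ℝ) (A : VecField P j ℝ)
    (dx : Fin P.d → Site P j → Site P j → ℝ) (D : Fin P.d → Fin P.d → SiteField P j ℝ) :
    curly1 η τ Gj Gj' g A dx D =
      ∑ ν : Fin P.d, ∑ x : Site P j, η ^ P.d * ∑ μ : Fin P.d, ∑ μ' : Fin P.d,
        g x * A ⟨x, μ⟩ * Pi3 η τ Gj Gj' dx μ μ' ν x * D ν μ' x := by
  unfold curly1
  exact Finset.sum_congr rfl fun ν _ =>
    pairSum_local η (fun μ μ' x x' => kerC η τ Gj Gj' μ μ' x x' * dx ν x x') g A (fun μ' x => D ν μ' x)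

/-- kernel (scaling of (G∂^{η*}_μ)): with η = sξ and G^η = a·G^ξ on the same sites, (G^η∂^{η*}_μ) = (a s^{−1})·(G^ξ∂^{ξ*}_μ).
[cite: Balaban1983Higgs3, (3.26) p.441] -/
theorem dAdjKernel_rescale (s ξ a : ℝ) (μ : Fin P.d) (G : Kernel P j) :
    dAdjKernel (s * ξ)⁻¹ μ (fun x x' => a * G x x') = fun y x' => a * s⁻¹ * dAdjKernel ξ⁻¹ μ G y x' := by
  funext y x'
  simp only [dAdjKernel, mul_inv]
  ring

/-- kernel (scaling of (∂^η_{μ′}G∂^{η*}_μ)): with η = sξ and G^η = a·G^ξ, the kernel scales by a s^{−2}. [cite: Balaban1983Higgs3, (3.26) p.441] -/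
theorem d2Kernel_rescale (s ξ a : ℝ) (μ' μ : Fin P.d) (G : Kernel P j) :
    d2Kernel (s * ξ)⁻¹ μ' μ (fun x x' => a * G x x') = fun x x' => a * s⁻¹ ^ 2 * d2Kernel ξ⁻¹ μ' μ G x x' := by
  funext x x'
  simp only [d2Kernel, mul_inv, mul_pow]
  ring

/-- kernel (scaling of the combined kernel of (3.26)): with η = sξ and both propagators scaled by a, `kerC` scales by a²s^{−2}.
[cite: Balaban1983Higgs3, (3.26) p.441] -/
theorem kerC_rescale (s ξ τ a : ℝ) (Gj Gj' : Kernel P j) (μ μ' : Fin P.d) :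
    kerC (s * ξ) τ (fun x x' => a * Gj x x') (fun x x' => a * Gj' x x') μ μ' =
      fun x x' => a ^ 2 * s⁻¹ ^ 2 * kerC ξ τ Gj Gj' μ μ' x x' := by
  funext x x'
  simp only [kerC, kerA, kerB, dAdjKernel_rescale, d2Kernel_rescale]
  ring

/-- p. 441 [PDF 31], the RESCALING of Π_{μμ′}, verbatim: *"Now let us rescale the functions Π^{(η,j₀)}_{μμ′}, Π^{(η,j₀)}_{μμ′ν}
from the η-lattice to the L^{−j₀}-lattice. We get Π^{(η,j₀)}_{μμ′}(x) = (L^{j₀}η)^{−d+2}Π^{(L^{−j₀},j₀)}_{μμ′}(y), …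
y = (L^{j₀}η)^{−1}x."* — PROVED from the scaling of the free propagators: with s = L^{j₀}η, ξ = L^{−j₀} (so η = sξ; the sites
of the two lattices are the same torus points, x ↔ y) and G^η(0)(x,x′) = (L^{j₀}η)^{−d+2}G^ξ(0)(y,y′) for the three propagators
(hypotheses `hGj`, `hGj'`, `hGj''`; (L^{j₀}η)^{−d+2} = s²/s^d). [cite: Balaban1983Higgs3, (3.26) p.441] -/
theorem Pi2_rescale (s ξ τ : ℝ) (hs : s ≠ 0) (Gjη Gj'η Gj''η Gjξ Gj'ξ Gj''ξ : Kernel P j)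
    (hGj : Gjη = fun x x' => s ^ 2 / s ^ P.d * Gjξ x x') (hGj' : Gj'η = fun x x' => s ^ 2 / s ^ P.d * Gj'ξ x x')
    (hGj'' : Gj''η = fun x x' => s ^ 2 / s ^ P.d * Gj''ξ x x') (μ μ' : Fin P.d) (x : Site P j) :
    Pi2 (s * ξ) τ Gjη Gj'η Gj''η μ μ' x = s ^ 2 / s ^ P.d * Pi2 ξ τ Gjξ Gj'ξ Gj''ξ μ μ' x := by
  have hsd : s ^ P.d ≠ 0 := pow_ne_zero _ hs
  have key : (s * ξ) ^ P.d * ((s ^ 2 / s ^ P.d) ^ 2 * s⁻¹ ^ 2) = s ^ 2 / s ^ P.d * ξ ^ P.d := by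
    rw [mul_pow]
    field_simp
  have key' : s * ξ * (s ^ 2 / s ^ P.d * s⁻¹) = s ^ 2 / s ^ P.d * ξ := by
    field_simp
  subst hGj hGj' hGj''
  simp only [Pi2, kerC_rescale, dAdjKernel_rescale]
  rw [mul_sub, mul_sub, Finset.mul_sum]
  congr 1
  congr 1
  · refine Finset.sum_congr rfl fun x' _ => ?_
    calc (s * ξ) ^ P.d * ((s ^ 2 / s ^ P.d) ^ 2 * s⁻¹ ^ 2 * kerC ξ τ Gjξ Gj'ξ μ μ' x x')
        = (s * ξ) ^ P.d * ((s ^ 2 / s ^ P.d) ^ 2 * s⁻¹ ^ 2) * kerC ξ τ Gjξ Gj'ξ μ μ' x x' := by ring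
      _ = s ^ 2 / s ^ P.d * (ξ ^ P.d * kerC ξ τ Gjξ Gj'ξ μ μ' x x') := by rw [key]; ring
  · split_ifs
    · ring
    · rw [mul_zero]
  · split_ifs
    · calc τ * (s * ξ * (s ^ 2 / s ^ P.d * s⁻¹ * dAdjKernel ξ⁻¹ μ Gj''ξ x x))
          = τ * (s * ξ * (s ^ 2 / s ^ P.d * s⁻¹) * dAdjKernel ξ⁻¹ μ Gj''ξ x x) := by ring
        _ = s ^ 2 / s ^ P.d * (τ * (ξ * dAdjKernel ξ⁻¹ μ Gj''ξ x x)) := by rw [key']; ring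
    · rw [mul_zero]

/-- p. 441 [PDF 31], the RESCALING of Π_{μμ′ν}, verbatim: *"Π^{(η,j₀)}_{μμ′ν}(x) = (L^{j₀}η)^{−d+3}Π^{(L^{−j₀},j₀)}_{μμ′ν}(y),
y = (L^{j₀}η)^{−1}x."* — PROVED from the same propagator scaling and the scaling of the coordinate differences,
x′_ν − x_ν = (L^{j₀}η)(y′_ν − y_ν) (`hdx`); (L^{j₀}η)^{−d+3} = s³/s^d. [cite: Balaban1983Higgs3, (3.26) p.441] -/
theorem Pi3_rescale (s ξ τ : ℝ) (hs : s ≠ 0) (Gjη Gj'η Gjξ Gj'ξ : Kernel P j)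
    (hGj : Gjη = fun x x' => s ^ 2 / s ^ P.d * Gjξ x x') (hGj' : Gj'η = fun x x' => s ^ 2 / s ^ P.d * Gj'ξ x x')
    (dxη dxξ : Fin P.d → Site P j → Site P j → ℝ) (hdx : dxη = fun ν x x' => s * dxξ ν x x')
    (μ μ' ν : Fin P.d) (x : Site P j) :
    Pi3 (s * ξ) τ Gjη Gj'η dxη μ μ' ν x = s ^ 3 / s ^ P.d * Pi3 ξ τ Gjξ Gj'ξ dxξ μ μ' ν x := by
  have hsd : s ^ P.d ≠ 0 := pow_ne_zero _ hs
  have key : (s * ξ) ^ P.d * ((s ^ 2 / s ^ P.d) ^ 2 * s⁻¹ ^ 2) * s = s ^ 3 / s ^ P.d * ξ ^ P.d := by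
    rw [mul_pow]
    field_simp
  subst hGj hGj' hdx
  simp only [Pi3, kerC_rescale]
  rw [Finset.mul_sum]
  refine Finset.sum_congr rfl fun x' _ => ?_
  calc (s * ξ) ^ P.d * ((s ^ 2 / s ^ P.d) ^ 2 * s⁻¹ ^ 2 * kerC ξ τ Gjξ Gj'ξ μ μ' x x' * (s * dxξ ν x x'))
      = (s * ξ) ^ P.d * ((s ^ 2 / s ^ P.d) ^ 2 * s⁻¹ ^ 2) * s * (kerC ξ τ Gjξ Gj'ξ μ μ' x x' * dxξ ν x x') := by ring
    _ = s ^ 3 / s ^ P.d * (ξ ^ P.d * (kerC ξ τ Gjξ Gj'ξ μ μ' x x' * dxξ ν x x')) := by rw [key]; ring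

/-- p. 441 [PDF 31], verbatim: *"We consider the case d = 3, so −d+2 = −1, −d+3 = 0."* [cite: Balaban1983Higgs3, (3.26) p.441] -/
theorem exponents_d3 : (-(3 : ℤ) + 2 = -1) ∧ (-(3 : ℤ) + 3 = 0) := by norm_num

end PiForms

/-! ## 5. (3.29): the Π_{μμ′} term on the ξ-lattice with the external legs rescaled, and the λ-sentence of p. 442 -/

section Eq329

variable {P : Params} {j : ℕ}

/-- The prefactor (L^{j₁}η)^{−(d−2)/2}(L^{j₀}η)^{d−(d−2)/2} of **(3.29)** p. 441 (`s1` = L^{j₁}η, `s0` = L^{j₀}η; real powers).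
[cite: Balaban1983Higgs3, (3.29) p.441] -/
def prefactor329 (s1 s0 : ℝ) (d : ℕ) : ℝ :=
  s1 ^ (-(((d : ℝ) - 2) / 2)) * s0 ^ ((d : ℝ) - ((d : ℝ) - 2) / 2)

/-- **(3.29)** p. 441 [PDF 31] (verbatim in the module docstring): the prefactor times the square bracket
[−Σ_{y,y′}ξ^{2d}Σ_{μμ′}gA_μ(y) tr q²(C^ξ∂^{ξ*}_{μ′})(y−y′)(C^ξ∂^{ξ*}_μ)(y′−y)g′(y)A′_{μ′}(y) + Σ ξ^{2d}Σ gA_μ(y) tr q²C^ξ(y−y′)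
(∂^ξ_{μ′}C^ξ∂^{ξ*}_μ)(y′−y)g′(y)A′_{μ′}(y) − Σ_yξ^dΣ_μ gA_μ g′A′_μ tr q²C^ξ(0) − Σ_yξ^dΣ_μ gA_μg′A′_μ tr q² ξ(C^ξ∂^{ξ*}_μ)(0)]
— which IS the square bracket of (3.26) on the ξ-lattice with all three propagators equal to C^ξ (kernel `C y y′` =
C^ξ(y−y′)): typed as `bracket326 ξ τ C C C`. T2: print has A′_{μ′}(y) under Σ_μ alone in the last two terms and omits
in the last term the factor ξ that (3.26) carries as η — typed in (3.26)'s form, flagged for the referee. [cite: Balaban1983Higgs3, (3.29) p.441] -/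
def expr329 (s1 s0 ξ τ : ℝ) (C : Kernel P j) (g g' : SiteField P j ℝ) (A A' : VecField P j ℝ) : ℝ :=
  prefactor329 s1 s0 P.d * bracket326 ξ τ C C C g g' A A'

/-- kernel: (3.29) inherits the Π-form of the bracket of (3.26): `expr329` = prefactor · Σ_yξ^dΣ_{μμ′}gA_μ(y)Π^{(ξ)}_{μμ′}(y)
g′(y)A′_{μ′}(y) with all propagators C^ξ. [cite: Balaban1983Higgs3, (3.29) p.441] -/
theorem expr329_eq_Pi2 (s1 s0 ξ τ : ℝ) (C : Kernel P j) (g g' : SiteField P j ℝ) (A A' : VecField P j ℝ) :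
    expr329 s1 s0 ξ τ C g g' A A' =
      prefactor329 s1 s0 P.d * ∑ y : Site P j, ξ ^ P.d * ∑ μ : Fin P.d, ∑ μ' : Fin P.d,
        g y * A ⟨y, μ⟩ * Pi2 ξ τ C C C μ μ' y * (g' y * A' ⟨y, μ'⟩) := by
  rw [expr329, bracket326_eq_Pi2]

end Eq329

/-! ## 6. The infinite ξ-lattice ξℤ^d: the free propagator C^ξ, (3.24), (3.27), (3.28), and the λ-sentence of p. 442 -/

section ZLattice

/-- Sites of the infinite ξ-lattice ξℤ^d in integer coordinates (the physical point is ξ·y). [cite: Balaban1983Higgs3, (3.27) p.441] -/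
abbrev ZSite (d : ℕ) : Type := Fin d → ℤ

variable {d : ℕ}

/-- the unit vector e_μ of ℤ^d. [cite: Balaban1983Higgs3, (3.27) p.441] -/
def unitVec (μ : Fin d) : ZSite d := Pi.single μ 1

/-- forward difference quotient on ξℤ^d: (∂^ξ_μf)(y) = c(f(y+e_μ) − f(y)), c = ξ^{−1}. [cite: Balaban1983Higgs3, (3.27) p.441] -/
def pdiffZ (c : ℝ) (μ : Fin d) (f : ZSite d → ℝ) : ZSite d → ℝ :=
  fun y => c * (f (y + unitVec μ) - f y)

/-- backward difference quotient on ξℤ^d: (∂^{ξ*}_μf)(y) = c(f(y−e_μ) − f(y)) (the sign convention of `LatticeFieldCalculus.pdiffAdj`).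
[cite: Balaban1983Higgs3, (3.27) p.441] -/
def pdiffAdjZ (c : ℝ) (μ : Fin d) (f : ZSite d → ℝ) : ZSite d → ℝ :=
  fun y => c * (f (y - unitVec μ) - f y)

/-- The Brillouin box "|p| ≤ π/ξ" of (3.24)/(3.28) (T4: max_μ |p_μ| ≤ π/ξ). [cite: Balaban1983Higgs3, (3.28) p.441] -/
def bzBox (d : ℕ) (ξ : ℝ) : Set (Fin d → ℝ) := {p | ∀ μ : Fin d, |p μ| ≤ Real.pi / ξ}

/-- Δ^ξ(p) = Σ_μ ξ^{−2}(2 − 2cos ξp_μ), the symbol of −Δ^ξ (T4; Δ¹(p′) = `lapSymbol d 1 p′`). [cite: Balaban1983Higgs3, (3.28) p.441] -/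
def lapSymbol (d : ℕ) (ξ : ℝ) (p : Fin d → ℝ) : ℝ :=
  ∑ μ : Fin d, ξ⁻¹ ^ 2 * (2 - 2 * Real.cos (ξ * p μ))

/-- The free propagator C^ξ = (−Δ^ξ + 1)^{−1} of (3.16) on ξℤ^d as its momentum integral,
C^ξ(y) = (2π)^{−d}∫_{|p|≤π/ξ} cos(ξp·y)/(Δ^ξ(p) + 1) dp (kernel with respect to Σ_{y′}ξ^d; y ∈ ℤ^d integer coordinates).
[cite: Balaban1983Higgs3, (3.16) p.437] -/
def Cxi (d : ℕ) (ξ : ℝ) (y : ZSite d) : ℝ :=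
  (2 * Real.pi)⁻¹ ^ d * ∫ p in bzBox d ξ, Real.cos (ξ * ∑ μ : Fin d, p μ * (y μ : ℝ)) / (lapSymbol d ξ p + 1)

/-- p. 441 [PDF 31], first identity used for (3.27), verbatim: *"We have used the identities C^ξ(−y′) = C^ξ(y′)"* — PROVED for
the momentum-integral C^ξ (cos is even). [cite: Balaban1983Higgs3, (3.27) p.441] -/
theorem Cxi_neg (ξ : ℝ) (y : ZSite d) : Cxi d ξ (-y) = Cxi d ξ y := by
  simp only [Cxi, Pi.neg_apply, Int.cast_neg, mul_neg, Finset.sum_neg_distrib, Real.cos_neg]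

/-- p. 441 [PDF 31], second identity used for (3.27), verbatim: *"(∂^ξ_μC^ξ)(−y′) = (∂^{ξ*}_μC^ξ)(y′)"* — PROVED for every even
kernel on ℤ^d (in particular C^ξ, `Cxi_neg`). [cite: Balaban1983Higgs3, (3.27) p.441] -/
theorem pdiffZ_neg_of_even (c : ℝ) (μ : Fin d) (f : ZSite d → ℝ) (hf : ∀ y, f (-y) = f y) (y : ZSite d) :
    pdiffZ c μ f (-y) = pdiffAdjZ c μ f y := by
  simp only [pdiffZ, pdiffAdjZ]
  rw [show -y + unitVec μ = -(y - unitVec μ) by abel, hf, hf]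

/-- kernel: the instance of the preceding identity for C^ξ. [cite: Balaban1983Higgs3, (3.27) p.441] -/
theorem pdiffZ_Cxi_neg (ξ c : ℝ) (μ : Fin d) (y : ZSite d) :
    pdiffZ c μ (Cxi d ξ) (-y) = pdiffAdjZ c μ (Cxi d ξ) y :=
  pdiffZ_neg_of_even c μ (Cxi d ξ) (Cxi_neg ξ) y

/-- **(3.24)** p. 439 [PDF 29] (row B3.Eq3.21-3.24), verbatim: *"We have further
Σ_{x′} ξ^d(∂^ξ_μC^ξ)(x−x′)C^ξ(x−x′) = (2π)^{−d}∫_{|p|≤π/ξ} dp ∂^ξ_μ(p)/(Δ^ξ(p)+1)² = (2π)^{−d}∫_{|p′|≤π} dp′ (cos p′_μ − 1)/(Δ¹(p′)+ξ²)² ξ^{3−d},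
(3.24) and the expression on the right side has a finite limit as ξ → 0."* — typed as the two equalities (T4: ∂^ξ_μ(p) read as its
real part ξ^{−1}(cos ξp_μ − 1); T5: the lattice sum as a `tsum`); the limit claim is not typed. [cite: Balaban1983Higgs3, (3.24) p.439] -/
def Eq324 (d : ℕ) (ξ : ℝ) : Prop :=
  ∀ (μ : Fin d) (x : ZSite d),
    (∑' x' : ZSite d, ξ ^ d * (pdiffZ ξ⁻¹ μ (Cxi d ξ) (x - x') * Cxi d ξ (x - x'))) =
        (2 * Real.pi)⁻¹ ^ d * ∫ p in bzBox d ξ, ξ⁻¹ * (Real.cos (ξ * p μ) - 1) / (lapSymbol d ξ p + 1) ^ 2 ∧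
      (2 * Real.pi)⁻¹ ^ d * ∫ p in bzBox d ξ, ξ⁻¹ * (Real.cos (ξ * p μ) - 1) / (lapSymbol d ξ p + 1) ^ 2 =
        (2 * Real.pi)⁻¹ ^ d * (∫ p' in bzBox d 1, (Real.cos (p' μ) - 1) / (lapSymbol d 1 p' + ξ ^ 2) ^ 2) *
          ξ ^ ((3 : ℤ) - d)

/-- The left side of **(3.27)** p. 441: tr q² Σ_{y′} ξ^d[−(C^ξ∂^{ξ*}_{μ′})(y−y′)(C^ξ∂^{ξ*}_μ)(y′−y)(y′_ν−y_ν)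
+ C^ξ(y−y′)(∂^ξ_{μ′}C^ξ∂^{ξ*}_μ)(y′−y)(y′_ν−y_ν)] — the x′-sum of Π_{μμ′ν} with all propagators C^ξ (translation-invariant
kernels on ξℤ^d: (C∂^{ξ*}_μ)(u) = (∂^{ξ*}_μC)(u), (∂^ξ_{μ′}C∂^{ξ*}_μ)(u) = (∂^ξ_{μ′}∂^{ξ*}_μC)(u); physical coordinate differences
y′_ν − y_ν = ξ(y′_ν − y_ν) for integer coordinates; T5). [cite: Balaban1983Higgs3, (3.27) p.441] -/
def lhs327 (d : ℕ) (ξ τ : ℝ) (y : ZSite d) (μ μ' ν : Fin d) : ℝ :=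
  τ * ∑' y' : ZSite d, ξ ^ d *
    (-(pdiffAdjZ ξ⁻¹ μ' (Cxi d ξ) (y - y') * pdiffAdjZ ξ⁻¹ μ (Cxi d ξ) (y' - y) * (ξ * ((y' ν : ℝ) - y ν))) +
      Cxi d ξ (y - y') * pdiffZ ξ⁻¹ μ' (pdiffAdjZ ξ⁻¹ μ (Cxi d ξ)) (y' - y) * (ξ * ((y' ν : ℝ) - y ν)))

/-- The lattice sum of **(3.28)** p. 441: S(μ,μ′) = Σ_{y′} ξ^d(C^ξ(y′+ξe_μ) − C^ξ(y′−ξe_μ))(∂^ξ_{μ′}C^ξ)(y′) (T5).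
[cite: Balaban1983Higgs3, (3.28) p.441] -/
def sum328 (d : ℕ) (ξ : ℝ) (μ μ' : Fin d) : ℝ :=
  ∑' y' : ZSite d, ξ ^ d * ((Cxi d ξ (y' + unitVec μ) - Cxi d ξ (y' - unitVec μ)) * pdiffZ ξ⁻¹ μ' (Cxi d ξ) y')

/-- The right side of **(3.27)** p. 441 as a function of the lattice sums S(μ,μ′): ½ tr q² S(μ,μ′)δ_{μν} − (μ↔μ′).
[cite: Balaban1983Higgs3, (3.27) p.441] -/
def rhs327 (τ : ℝ) (S : Fin d → Fin d → ℝ) (μ μ' ν : Fin d) : ℝ :=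
  1 / 2 * τ * S μ μ' * (if μ = ν then 1 else 0) - 1 / 2 * τ * S μ' μ * (if μ' = ν then 1 else 0)

/-- **(3.27)** p. 441 [PDF 31], verbatim (first and last members): *"tr q² Σ_{y′} ξ^d[−(C^ξ∂^{ξ*}_{μ′})(y−y′)(C^ξ∂^{ξ*}_μ)(y′−y)
(y′_ν−y_ν) + C^ξ(y−y′)(∂^ξ_{μ′}C^ξ∂^{ξ*}_μ)(y′−y)(y′_ν−y_ν)] = … = ½ tr q² Σ_{y′} ξ^d(C^ξ(y′+ξe_μ) − C^ξ(y′−ξe_μ))(∂^ξ_{μ′}C^ξ)(y′)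
δ_{μν} − (μ↔μ′). (3.27)"* — typed as the equality of the first and last members for C^ξ = `Cxi` (the middle member, obtained by
the two identities above and summation by parts, is not typed). [cite: Balaban1983Higgs3, (3.27) p.441] -/
def Eq327 (d : ℕ) (ξ τ : ℝ) : Prop :=
  ∀ (y : ZSite d) (μ μ' ν : Fin d), lhs327 d ξ τ y μ μ' ν = rhs327 τ (sum328 d ξ) μ μ' ν

/-- **(3.28)** p. 441 [PDF 31], verbatim: *"Σ_{y′} ξ^d(C^ξ(y′+ξe_μ) − C^ξ(y′−ξe_μ))(∂^ξ_{μ′}C^ξ)(y′) = 2(2π)^{−d}∫_{|p|≤π/ξ} dp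
ξ^{−1} sin ξp_μ sin ξp_{μ′}/(Δ^ξ(p)+1)² = (2/d)(2π)^{−d}∫_{|p′|≤π} dp′ (Σ_{μ=1}^d sin²p′_μ)/(Δ¹(p′)+ξ²)² ξ^{3−d}δ_{μμ′}, (3.28)"*
— typed as the two equalities (T4, T5). [cite: Balaban1983Higgs3, (3.28) p.441] -/
def Eq328 (d : ℕ) (ξ : ℝ) : Prop :=
  ∀ μ μ' : Fin d,
    sum328 d ξ μ μ' =
        2 * (2 * Real.pi)⁻¹ ^ d *
          ∫ p in bzBox d ξ, ξ⁻¹ * Real.sin (ξ * p μ) * Real.sin (ξ * p μ') / (lapSymbol d ξ p + 1) ^ 2 ∧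
      2 * (2 * Real.pi)⁻¹ ^ d *
          ∫ p in bzBox d ξ, ξ⁻¹ * Real.sin (ξ * p μ) * Real.sin (ξ * p μ') / (lapSymbol d ξ p + 1) ^ 2 =
        2 / d * (2 * Real.pi)⁻¹ ^ d *
            (∫ p' in bzBox d 1, (∑ κ : Fin d, Real.sin (p' κ) ^ 2) / (lapSymbol d 1 p' + ξ ^ 2) ^ 2) *
          ξ ^ ((3 : ℤ) - d) * (if μ = μ' then 1 else 0)

/-- p. 441 [PDF 31], the inference after (3.28), verbatim: *"which is symmetric in μ, μ′, hence finally the term (3.27) is equal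
to 0."* — PROVED in the form the argument uses: the last member of (3.27) vanishes as soon as the lattice sums S(μ,μ′) of (3.28)
are DIAGONAL in (μ,μ′) (the δ_{μμ′} of (3.28)); T6: symmetry S(μ,μ′) = S(μ′,μ) alone would not suffice (S ≡ 1, μ = ν ≠ μ′
gives ½ tr q²). [cite: Balaban1983Higgs3, (3.28) p.441] -/
theorem rhs327_eq_zero_of_diag (τ : ℝ) (S : Fin d → Fin d → ℝ) (hS : ∀ μ μ' : Fin d, μ ≠ μ' → S μ μ' = 0)
    (μ μ' ν : Fin d) : rhs327 τ S μ μ' ν = 0 := by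
  unfold rhs327
  by_cases h : μ = μ'
  · subst h
    ring
  · rw [hS μ μ' h, hS μ' μ (Ne.symm h)]
    ring

/-- kernel: hence (3.27) = 0 for every (μ,μ′,ν) once (3.27) and the diagonality of (3.28) hold. [cite: Balaban1983Higgs3, (3.28) p.441] -/
theorem lhs327_eq_zero (ξ τ : ℝ) (h327 : Eq327 d ξ τ) (hdiag : ∀ μ μ' : Fin d, μ ≠ μ' → sum328 d ξ μ μ' = 0)
    (y : ZSite d) (μ μ' ν : Fin d) : lhs327 d ξ τ y μ μ' ν = 0 := by
  rw [h327 y μ μ' ν]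
  exact rhs327_eq_zero_of_diag τ _ hdiag μ μ' ν

/-- The function λ of p. 442 [PDF 32]: λ(y′) = Σ_{μ′=1}^d g′(y)A′_{μ′}(y)(y′_{μ′} − y_{μ′}) on ξℤ^d (`coef μ′` = g′(y)A′_{μ′}(y),
physical coordinates ξ·y′). [cite: Balaban1983Higgs3, (3.29) p.442] -/
def lambda442 (ξ : ℝ) (coef : Fin d → ℝ) (y : ZSite d) : ZSite d → ℝ :=
  fun y' => ∑ μ' : Fin d, coef μ' * (ξ * ((y' μ' : ℝ) - y μ'))

/-- p. 442 [PDF 32], verbatim: *"Now if we introduce the function λ(y′) = Σ_{μ′=1}^d g′(y)A′_{μ′}(y)(y′_{μ′} − y_{μ′}), then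
(∂^ξ_{μ′}λ)(y′) = g′(y)A′_{μ′}(y)"* — PROVED on ξℤ^d. (The sequel — the bracket of (3.29) "has exactly the form appearing in the
Ward-Takahashi identity (2.26) with M² = 1, hence it is equal to 0" — is the paper's inference from row B3.Eq2.26-2.28 and is
not typed.) [cite: Balaban1983Higgs3, (3.29) p.442] -/
theorem pdiffZ_lambda442 (ξ : ℝ) (hξ : ξ ≠ 0) (coef : Fin d → ℝ) (y y' : ZSite d) (μ' : Fin d) :
    pdiffZ ξ⁻¹ μ' (lambda442 ξ coef y) y' = coef μ' := by
  simp only [pdiffZ, lambda442, unitVec]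
  rw [← Finset.sum_sub_distrib]
  have hterm : ∀ ν : Fin d,
      coef ν * (ξ * (((y' + Pi.single μ' (1 : ℤ) : ZSite d) ν : ℝ) - (y ν : ℝ))) - coef ν * (ξ * ((y' ν : ℝ) - y ν)) =
        if ν = μ' then coef μ' * ξ else 0 := by
    intro ν
    rw [Pi.add_apply, Pi.single_apply]
    split_ifs with h
    · subst h
      push_cast
      ring
    · push_cast
      ring
  simp_rw [hterm]
  rw [Finset.sum_ite_eq', if_pos (Finset.mem_univ _)]
  field_simp

end ZLattice

/-! ## 7. (3.31): the degree-0 graphs, split into a convergent term and a local term -/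

section Eq331

variable {P : Params} {j : ℕ}

/-- kernel: on the torus, sup-distance 0 means equality. [folklore] -/
private theorem eq_of_supDist_eq_zero (x x' : Site P j) (h : supDist x x' = 0) : x = x' := by
  funext μ
  have hle : min (x μ - x' μ).val (x' μ - x μ).val ≤ supDist x x' :=
    Finset.le_sup (f := fun μ : Fin P.d => min (x μ - x' μ).val (x' μ - x μ).val) (Finset.mem_univ μ)
  rw [h, Nat.le_zero, Nat.min_eq_zero_iff, ZMod.val_eq_zero, ZMod.val_eq_zero, sub_eq_zero, sub_eq_zero] at hle
  rcases hle with h1 | h1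
  · exact h1
  · exact h1.symm

/-- **(3.31)** p. 442 [PDF 32], generic form — PROVED for any two-point weight `w` vanishing only on the diagonal (in print
w(x,x′) = |x′−x|^α): Σ_{x,x′}η^{2d}Σ_{μμ′}gA_μ(x)Π_{μμ′}(x,x′)g′(x′)A′_{μ′}(x′) = Σ_{x,x′}η^{2d}Σ_{μμ′}gA_μ(x)Π_{μμ′}(x,x′)w(x,x′)
(g′(x′)A′_{μ′}(x′) − g′(x)A′_{μ′}(x))/w(x,x′) + Σ_xη^dΣ_{μμ′}gA_μ(x)(Σ_{x′}η^dΠ_{μμ′}(x,x′))g′(x)A′_{μ′}(x).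
[cite: Balaban1983Higgs3, (3.31) p.442] -/
theorem eq331_of_weight (η : ℝ) (K : Fin P.d → Fin P.d → Kernel P j) (g g' : SiteField P j ℝ) (A A' : VecField P j ℝ)
    (w : Site P j → Site P j → ℝ) (hw : ∀ x x' : Site P j, w x x' = 0 → x = x') :
    pairSum η K g A (legFar g' A') =
      pairSum η K g A (fun μ' x x' => w x x' * ((g' x' * A' ⟨x', μ'⟩ - g' x * A' ⟨x, μ'⟩) / w x x')) +
        ∑ x : Site P j, η ^ P.d * ∑ μ : Fin P.d, ∑ μ' : Fin P.d,
          g x * A ⟨x, μ⟩ * (∑ x' : Site P j, η ^ P.d * K μ μ' x x') * (g' x * A' ⟨x, μ'⟩) := by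
  have hleg : legFar g' A' = fun μ' x x' =>
      w x x' * ((g' x' * A' ⟨x', μ'⟩ - g' x * A' ⟨x, μ'⟩) / w x x') + g' x * A' ⟨x, μ'⟩ := by
    funext μ' x x'
    simp only [legFar]
    by_cases h0 : w x x' = 0
    · have hx := hw x x' h0
      subst hx
      rw [sub_self, zero_div, mul_zero, zero_add]
    · rw [mul_div_cancel₀ _ h0]
      ring
  rw [hleg, pairSum_add_leg, pairSum_local η K g A (fun μ' x => g' x * A' ⟨x, μ'⟩)]

/-- **(3.31)** p. 442 [PDF 32], verbatim: *"We write Σ_{x,x′}η^{2d}Σ_{μ,μ′=1}^d g(x)A_μ(x)Π_{μμ′}(x,x′)g′(x′)A′_{μ′}(x′)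
= Σ_{x,x′}η^{2d}Σ_{μ,μ′=1}^d g(x)A_μ(x)Π_{μμ′}(x,x′)|x′−x|^α (g′(x′)A′_{μ′}(x′) − g′(x)A′_{μ′}(x))/|x′−x|^α
+ Σ_xη^dΣ_{μ,μ′=1}^d g(x)A_μ(x)(Σ_{x′}η^dΠ_{μμ′}(x,x′))g′(x)A′_{μ′}(x), (3.31)"* — PROVED, with |x′−x| = η·(sup torus distance
in lattice steps, `LatticeFieldCalculus.supDist`), η > 0, any real exponent α (Π_{μμ′}(x,x′) an arbitrary two-point kernel of
the degree-0 graphs). [cite: Balaban1983Higgs3, (3.31) p.442] -/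
theorem eq331 (η α : ℝ) (hη : 0 < η) (K : Fin P.d → Fin P.d → Kernel P j) (g g' : SiteField P j ℝ)
    (A A' : VecField P j ℝ) :
    pairSum η K g A (legFar g' A') =
      pairSum η K g A (fun μ' x x' => (η * supDist x x') ^ α *
          ((g' x' * A' ⟨x', μ'⟩ - g' x * A' ⟨x, μ'⟩) / (η * supDist x x') ^ α)) +
        ∑ x : Site P j, η ^ P.d * ∑ μ : Fin P.d, ∑ μ' : Fin P.d,
          g x * A ⟨x, μ⟩ * (∑ x' : Site P j, η ^ P.d * K μ μ' x x') * (g' x * A' ⟨x, μ'⟩) :=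
  eq331_of_weight η K g g' A A' (fun x x' => (η * supDist x x') ^ α) fun x x' h0 => by
    have hnn : 0 ≤ η * (supDist x x' : ℝ) := by positivity
    rw [Real.rpow_eq_zero_iff_of_nonneg hnn] at h0
    have h1 : (supDist x x' : ℝ) = 0 := by
      rcases mul_eq_zero.1 h0.1 with h2 | h2
      · exact absurd h2 hη.ne'
      · exact h2
    exact eq_of_supDist_eq_zero x x' (by exact_mod_cast h1)

end Eq331

/-! ## v1.1 (append-only): the ξ-rescaling p = p′/ξ of the momentum integrals in (3.24) and (3.28), PROVED -/

section MomentumRescaling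

variable {d : ℕ} {ξ : ℝ}

/-- kernel: the Brillouin box is measurable (closed). [folklore] -/
private theorem measurableSet_bzBox (d : ℕ) (ξ : ℝ) : MeasurableSet (bzBox d ξ) := by
  have h : bzBox d ξ = ⋂ μ : Fin d, {p : Fin d → ℝ | |p μ| ≤ Real.pi / ξ} := by
    ext p
    simp only [bzBox, Set.mem_setOf_eq, Set.mem_iInter]
  rw [h]
  exact MeasurableSet.iInter fun μ => (isClosed_le (continuous_apply μ).abs continuous_const).measurableSet

/-- kernel: for ξ > 0 the dilation p ↦ ξp pulls the box |p′| ≤ π back to the box |p| ≤ π/ξ. [folklore] -/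
private theorem preimage_smul_bzBox (hξ : 0 < ξ) : (fun p : Fin d → ℝ => ξ • p) ⁻¹' bzBox d 1 = bzBox d ξ := by
  ext p
  simp only [bzBox, Set.mem_preimage, Set.mem_setOf_eq, Pi.smul_apply, smul_eq_mul, abs_mul, abs_of_pos hξ,
    div_one]
  refine forall_congr' fun μ => ?_
  rw [le_div_iff₀ hξ, mul_comm]

/-- kernel (the change of variables p = p′/ξ of (3.24)/(3.28)): ∫_{|p|≤π/ξ} g(ξp) dp = ξ^{−d}∫_{|p′|≤π} g(p′) dp′ for ξ > 0
(Lebesgue measure on ℝ^d scales by ξ^{−d} under p ↦ ξp). [cite: Balaban1983Higgs3, (3.24) p.439] -/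
theorem integral_bzBox_comp_smul (hξ : 0 < ξ) (g : (Fin d → ℝ) → ℝ) :
    ∫ p in bzBox d ξ, g (ξ • p) = (ξ ^ d)⁻¹ * ∫ p in bzBox d 1, g p := by
  rw [← integral_indicator (measurableSet_bzBox d ξ), ← integral_indicator (measurableSet_bzBox d 1)]
  have h1 : (bzBox d ξ).indicator (fun p => g (ξ • p)) = fun p => (bzBox d 1).indicator g (ξ • p) := by
    funext p
    rw [← preimage_smul_bzBox hξ]
    exact Set.indicator_comp_right (fun p : Fin d → ℝ => ξ • p)
  rw [h1, Measure.integral_comp_smul volume ((bzBox d 1).indicator g) ξ, Module.finrank_fin_fun, smul_eq_mul,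
    abs_of_nonneg (inv_nonneg.2 (pow_nonneg hξ.le _))]

/-- kernel: Δ^ξ(p) ≥ 0. [cite: Balaban1983Higgs3, (3.28) p.441] -/
theorem lapSymbol_nonneg (d : ℕ) (ξ : ℝ) (p : Fin d → ℝ) : 0 ≤ lapSymbol d ξ p :=
  Finset.sum_nonneg fun μ _ => mul_nonneg (pow_two_nonneg _) (by linarith [Real.cos_le_one (ξ * p μ)])

/-- kernel (T4): Δ^ξ(p) = ξ^{−2}Δ¹(ξp) — the symbol rescales as the Laplacian. [cite: Balaban1983Higgs3, (3.28) p.441] -/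
theorem lapSymbol_eq_smul (ξ : ℝ) (p : Fin d → ℝ) : lapSymbol d ξ p = ξ⁻¹ ^ 2 * lapSymbol d 1 (ξ • p) := by
  simp only [lapSymbol, Pi.smul_apply, smul_eq_mul, inv_one, one_pow, one_mul, Finset.mul_sum]

/-- **(3.24)** p. 439 [PDF 29], its SECOND equality — PROVED (ξ > 0): (2π)^{−d}∫_{|p|≤π/ξ} dp ∂^ξ_μ(p)/(Δ^ξ(p)+1)² =
(2π)^{−d}∫_{|p′|≤π} dp′ (cos p′_μ − 1)/(Δ¹(p′)+ξ²)² ξ^{3−d}, by p = p′/ξ, Δ^ξ(p′/ξ) = ξ^{−2}Δ¹(p′) (T4: ∂^ξ_μ(p) read as its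
real part ξ^{−1}(cos ξp_μ − 1)). [cite: Balaban1983Higgs3, (3.24) p.439] -/
theorem eq324_rescale (hξ : 0 < ξ) (μ : Fin d) :
    (2 * Real.pi)⁻¹ ^ d * ∫ p in bzBox d ξ, ξ⁻¹ * (Real.cos (ξ * p μ) - 1) / (lapSymbol d ξ p + 1) ^ 2 =
      (2 * Real.pi)⁻¹ ^ d * (∫ p' in bzBox d 1, (Real.cos (p' μ) - 1) / (lapSymbol d 1 p' + ξ ^ 2) ^ 2) *
        ξ ^ ((3 : ℤ) - d) := by
  have hξ0 : ξ ≠ 0 := hξ.ne'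
  have hpt : ∀ p : Fin d → ℝ, ξ⁻¹ * (Real.cos (ξ * p μ) - 1) / (lapSymbol d ξ p + 1) ^ 2 =
      ξ ^ 3 * ((Real.cos ((ξ • p) μ) - 1) / (lapSymbol d 1 (ξ • p) + ξ ^ 2) ^ 2) := by
    intro p
    have hΛ : 0 < lapSymbol d 1 (ξ • p) + ξ ^ 2 := add_pos_of_nonneg_of_pos (lapSymbol_nonneg d 1 _) (pow_pos hξ 2)
    rw [lapSymbol_eq_smul ξ p, Pi.smul_apply, smul_eq_mul]
    field_simp
  simp_rw [hpt]
  rw [integral_const_mul, integral_bzBox_comp_smul hξ (fun q => (Real.cos (q μ) - 1) / (lapSymbol d 1 q + ξ ^ 2) ^ 2),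
    zpow_sub₀ hξ0, zpow_natCast]
  rw [show (ξ ^ (3 : ℤ)) = ξ ^ 3 from zpow_ofNat ξ 3]
  field_simp

/-- **(3.28)** p. 441 [PDF 31], the rescaling step of its SECOND equality — PROVED (ξ > 0): 2(2π)^{−d}∫_{|p|≤π/ξ} dp
ξ^{−1} sin ξp_μ sin ξp_{μ′}/(Δ^ξ(p)+1)² = 2(2π)^{−d}[∫_{|p′|≤π} dp′ sin p′_μ sin p′_{μ′}/(Δ¹(p′)+ξ²)²] ξ^{3−d}; the remaining
printed step (the bracket equals (1/d)δ_{μμ′}∫(Σ_κ sin²p′_κ)/(Δ¹(p′)+ξ²)², by reflection and permutation symmetry of the box)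
is the second conjunct of `Eq328` and is not proved here. [cite: Balaban1983Higgs3, (3.28) p.441] -/
theorem eq328_rescale (hξ : 0 < ξ) (μ μ' : Fin d) :
    2 * (2 * Real.pi)⁻¹ ^ d *
        ∫ p in bzBox d ξ, ξ⁻¹ * Real.sin (ξ * p μ) * Real.sin (ξ * p μ') / (lapSymbol d ξ p + 1) ^ 2 =
      2 * (2 * Real.pi)⁻¹ ^ d *
          (∫ p' in bzBox d 1, Real.sin (p' μ) * Real.sin (p' μ') / (lapSymbol d 1 p' + ξ ^ 2) ^ 2) *
        ξ ^ ((3 : ℤ) - d) := by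
  have hξ0 : ξ ≠ 0 := hξ.ne'
  have hpt : ∀ p : Fin d → ℝ, ξ⁻¹ * Real.sin (ξ * p μ) * Real.sin (ξ * p μ') / (lapSymbol d ξ p + 1) ^ 2 =
      ξ ^ 3 * (Real.sin ((ξ • p) μ) * Real.sin ((ξ • p) μ') / (lapSymbol d 1 (ξ • p) + ξ ^ 2) ^ 2) := by
    intro p
    have hΛ : 0 < lapSymbol d 1 (ξ • p) + ξ ^ 2 := add_pos_of_nonneg_of_pos (lapSymbol_nonneg d 1 _) (pow_pos hξ 2)
    rw [lapSymbol_eq_smul ξ p, Pi.smul_apply, Pi.smul_apply, smul_eq_mul, smul_eq_mul]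
    field_simp
  simp_rw [hpt]
  rw [integral_const_mul,
    integral_bzBox_comp_smul hξ (fun q => Real.sin (q μ) * Real.sin (q μ') / (lapSymbol d 1 q + ξ ^ 2) ^ 2),
    zpow_sub₀ hξ0, zpow_natCast]
  rw [show (ξ ^ (3 : ℤ)) = ξ ^ 3 from zpow_ofNat ξ 3]
  field_simp

end MomentumRescaling

/-! ## v1.1 (cont.): the symmetry step of (3.28) — reflection and permutation symmetry of the Brillouin box, PROVED -/

section MomentumSymmetry

variable {d : ℕ} {ξ : ℝ}

/-- kernel: the Brillouin box as a product of intervals. [folklore] -/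
private theorem bzBox_eq_pi (d : ℕ) (ξ : ℝ) :
    bzBox d ξ = Set.univ.pi fun _ : Fin d => Set.Icc (-(Real.pi / ξ)) (Real.pi / ξ) := by
  ext p
  simp only [bzBox, Set.mem_setOf_eq, Set.mem_univ_pi, Set.mem_Icc, abs_le]

/-- kernel: the Brillouin box is compact. [folklore] -/
private theorem isCompact_bzBox (d : ℕ) (ξ : ℝ) : IsCompact (bzBox d ξ) := by
  rw [bzBox_eq_pi]
  exact isCompact_univ_pi fun _ => isCompact_Icc

/-- kernel: Δ^ξ(p) is continuous in p. [folklore] -/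
private theorem continuous_lapSymbol (d : ℕ) (ξ : ℝ) : Continuous (lapSymbol d ξ) := by
  unfold lapSymbol
  fun_prop

/-- kernel: transport of a box integral along a volume-preserving equivalence mapping the box onto itself. [folklore] -/
private theorem setIntegral_bzBox_comp (T : (Fin d → ℝ) ≃ᵐ (Fin d → ℝ)) (hT : MeasurePreserving T volume volume)
    (hbox : ∀ p, T p ∈ bzBox d 1 ↔ p ∈ bzBox d 1) (F : (Fin d → ℝ) → ℝ) :
    ∫ p in bzBox d 1, F (T p) = ∫ p in bzBox d 1, F p := by
  rw [← integral_indicator (measurableSet_bzBox d 1), ← integral_indicator (measurableSet_bzBox d 1)]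
  have h : (bzBox d 1).indicator (fun p => F (T p)) = fun p => (bzBox d 1).indicator F (T p) := by
    funext p
    by_cases hp : p ∈ bzBox d 1
    · rw [Set.indicator_of_mem hp, Set.indicator_of_mem ((hbox p).2 hp)]
    · rw [Set.indicator_of_notMem hp, Set.indicator_of_notMem (fun h => hp ((hbox p).1 h))]
  rw [h]
  exact hT.integral_comp' (fun p => (bzBox d 1).indicator F p)

/-- the coordinate reflection p_μ ↦ −p_μ of ℝ^d. [folklore] -/
private def refl (μ : Fin d) (p : Fin d → ℝ) : Fin d → ℝ := fun i => if i = μ then -p i else p i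

/-- kernel: the reflection is an involution. [folklore] -/
private theorem refl_refl (μ : Fin d) (p : Fin d → ℝ) : refl μ (refl μ p) = p := by
  funext i
  by_cases h : i = μ <;> simp [refl, h]

/-- kernel: the reflection is measurable. [folklore] -/
private theorem measurable_refl (μ : Fin d) : Measurable (refl (d := d) μ) := by
  refine measurable_pi_iff.2 fun i => ?_
  by_cases h : i = μ
  · simp only [refl, h, if_true]
    exact (measurable_pi_apply μ).neg
  · simp only [refl, h, if_false]
    exact measurable_pi_apply i

/-- the reflection as a measurable equivalence. [folklore] -/
private def reflMEquiv (μ : Fin d) : (Fin d → ℝ) ≃ᵐ (Fin d → ℝ) where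
  toFun := refl μ
  invFun := refl μ
  left_inv := refl_refl μ
  right_inv := refl_refl μ
  measurable_toFun := measurable_refl μ
  measurable_invFun := measurable_refl μ

/-- kernel: the reflection preserves Lebesgue measure on ℝ^d (product of the reflection of one factor with identities). [folklore] -/
private theorem measurePreserving_refl (μ : Fin d) : MeasurePreserving (reflMEquiv (d := d) μ) volume volume := by
  have hf : ∀ i : Fin d,
      MeasurePreserving ((fun i : Fin d => if i = μ then (fun x : ℝ => -x) else fun x : ℝ => x) i) volume volume := by
    intro i
    by_cases hi : i = μ
    · simp only [hi, if_true]
      exact Measure.measurePreserving_neg volume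
    · simp only [hi, if_false]
      exact MeasurePreserving.id volume
  have h := volume_preserving_pi hf
  have hfun : (fun a : Fin d → ℝ => fun i => (if i = μ then (fun x : ℝ => -x) else fun x : ℝ => x) (a i)) =
      ⇑(reflMEquiv (d := d) μ) := by
    funext p i
    show _ = refl μ p i
    simp only [refl]
    split_ifs <;> rfl
  rw [hfun] at h
  exact h

/-- kernel: the reflection maps the box onto itself. [folklore] -/
private theorem refl_mem_bzBox (μ : Fin d) (p : Fin d → ℝ) : refl μ p ∈ bzBox d 1 ↔ p ∈ bzBox d 1 := by
  simp only [bzBox, Set.mem_setOf_eq, refl]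
  refine forall_congr' fun i => ?_
  split_ifs
  · rw [abs_neg]
  · exact Iff.rfl

/-- kernel: Δ¹ is invariant under the reflection. [folklore] -/
private theorem lapSymbol_refl (μ : Fin d) (p : Fin d → ℝ) : lapSymbol d 1 (refl μ p) = lapSymbol d 1 p := by
  unfold lapSymbol
  refine Finset.sum_congr rfl fun i _ => ?_
  simp only [refl]
  split_ifs
  · rw [mul_neg, Real.cos_neg]
  · rfl

/-- **(3.28)**, symmetry step, off-diagonal part — PROVED: for μ ≠ μ′, ∫_{|p′|≤π} sin p′_μ sin p′_{μ′}/(Δ¹(p′)+ξ²)² dp′ = 0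
(the integrand is odd under p′_μ ↦ −p′_μ, the box and Δ¹ are invariant). [cite: Balaban1983Higgs3, (3.28) p.441] -/
theorem integral328_offDiag {μ μ' : Fin d} (hne : μ ≠ μ') (ξ : ℝ) :
    ∫ p in bzBox d 1, Real.sin (p μ) * Real.sin (p μ') / (lapSymbol d 1 p + ξ ^ 2) ^ 2 = 0 := by
  set F : (Fin d → ℝ) → ℝ := fun p => Real.sin (p μ) * Real.sin (p μ') / (lapSymbol d 1 p + ξ ^ 2) ^ 2 with hF
  have hodd : ∀ p, F (reflMEquiv μ p) = -F p := by
    intro p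
    show F (refl μ p) = -F p
    simp only [hF, lapSymbol_refl]
    have h1 : refl μ p μ = -p μ := by simp [refl]
    have h2 : refl μ p μ' = p μ' := by simp [refl, Ne.symm hne]
    rw [h1, h2, Real.sin_neg]
    ring
  have h := setIntegral_bzBox_comp (reflMEquiv μ) (measurePreserving_refl μ) (fun p => refl_mem_bzBox μ p) F
  simp_rw [hodd, integral_neg] at h
  show ∫ p in bzBox d 1, F p = 0
  linarith

/-- the coordinate transposition of ℝ^d exchanging the μ-th and κ-th coordinates, as a measurable equivalence. [folklore] -/
private def swapMEquiv (μ κ : Fin d) : (Fin d → ℝ) ≃ᵐ (Fin d → ℝ) :=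
  MeasurableEquiv.piCongrLeft (fun _ : Fin d => ℝ) (Equiv.swap μ κ)

/-- kernel: the transposition acts by p ↦ p ∘ swap. [folklore] -/
private theorem swapMEquiv_apply (μ κ : Fin d) (p : Fin d → ℝ) (i : Fin d) :
    swapMEquiv μ κ p i = p (Equiv.swap μ κ i) := by
  have h := MeasurableEquiv.piCongrLeft_apply_apply (Equiv.swap μ κ) (β := fun _ : Fin d => ℝ) p (Equiv.swap μ κ i)
  rw [Equiv.swap_apply_self] at h
  exact h

/-- kernel: the transposition preserves Lebesgue measure on ℝ^d. [folklore] -/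
private theorem measurePreserving_swap (μ κ : Fin d) : MeasurePreserving (swapMEquiv (d := d) μ κ) volume volume :=
  volume_measurePreserving_piCongrLeft (fun _ : Fin d => ℝ) (Equiv.swap μ κ)

/-- kernel: the transposition maps the box onto itself. [folklore] -/
private theorem swap_mem_bzBox (μ κ : Fin d) (p : Fin d → ℝ) : swapMEquiv μ κ p ∈ bzBox d 1 ↔ p ∈ bzBox d 1 := by
  simp only [bzBox, Set.mem_setOf_eq, swapMEquiv_apply]
  constructor
  · intro h i
    have := h (Equiv.swap μ κ i)
    rwa [Equiv.swap_apply_self] at this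
  · intro h i
    exact h _

/-- kernel: Δ¹ is invariant under the transposition. [folklore] -/
private theorem lapSymbol_swap (μ κ : Fin d) (p : Fin d → ℝ) : lapSymbol d 1 (swapMEquiv μ κ p) = lapSymbol d 1 p := by
  unfold lapSymbol
  simp only [swapMEquiv_apply]
  exact Equiv.sum_comp (Equiv.swap μ κ) (fun i => (1 : ℝ)⁻¹ ^ 2 * (2 - 2 * Real.cos (1 * p i)))

/-- **(3.28)**, symmetry step, diagonal part — PROVED: the box integrals ∫_{|p′|≤π} sin²p′_μ/(Δ¹(p′)+ξ²)² dp′ do not depend on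
the direction μ (permutation symmetry of the box and of Δ¹). [cite: Balaban1983Higgs3, (3.28) p.441] -/
theorem integral328_diag_eq (μ κ : Fin d) (ξ : ℝ) :
    ∫ p in bzBox d 1, Real.sin (p μ) * Real.sin (p μ) / (lapSymbol d 1 p + ξ ^ 2) ^ 2 =
      ∫ p in bzBox d 1, Real.sin (p κ) * Real.sin (p κ) / (lapSymbol d 1 p + ξ ^ 2) ^ 2 := by
  have h := setIntegral_bzBox_comp (swapMEquiv μ κ) (measurePreserving_swap μ κ) (swap_mem_bzBox μ κ)
    (fun p => Real.sin (p μ) * Real.sin (p μ) / (lapSymbol d 1 p + ξ ^ 2) ^ 2)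
  simp only [lapSymbol_swap, swapMEquiv_apply, Equiv.swap_apply_left] at h
  exact h.symm

/-- kernel: the summands of (3.28) are integrable on the box (continuous on a compact set; ξ > 0). [folklore] -/
private theorem integrableOn_term (hξ : 0 < ξ) (κ : Fin d) :
    IntegrableOn (fun p : Fin d → ℝ => Real.sin (p κ) * Real.sin (p κ) / (lapSymbol d 1 p + ξ ^ 2) ^ 2)
      (bzBox d 1) volume := by
  refine ContinuousOn.integrableOn_compact (isCompact_bzBox d 1) (Continuous.continuousOn ?_)
  have hden : ∀ p : Fin d → ℝ, (lapSymbol d 1 p + ξ ^ 2) ^ 2 ≠ 0 := fun p =>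
    pow_ne_zero _ (add_pos_of_nonneg_of_pos (lapSymbol_nonneg d 1 p) (pow_pos hξ 2)).ne'
  exact Continuous.div (by fun_prop) (((continuous_lapSymbol d 1).add continuous_const).pow 2) hden

/-- **(3.28)** p. 441, the symmetry step of its SECOND equality — PROVED (ξ > 0): ∫_{|p′|≤π} dp′ sin p′_μ sin p′_{μ′}/(Δ¹(p′)+ξ²)²
= (1/d) δ_{μμ′} ∫_{|p′|≤π} dp′ (Σ_{κ=1}^d sin²p′_κ)/(Δ¹(p′)+ξ²)² (reflection symmetry kills μ ≠ μ′, permutation symmetry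
averages the diagonal over the d directions). [cite: Balaban1983Higgs3, (3.28) p.441] -/
theorem integral328_symmetry (hξ : 0 < ξ) (μ μ' : Fin d) :
    ∫ p in bzBox d 1, Real.sin (p μ) * Real.sin (p μ') / (lapSymbol d 1 p + ξ ^ 2) ^ 2 =
      1 / d * (∫ p in bzBox d 1, (∑ κ : Fin d, Real.sin (p κ) ^ 2) / (lapSymbol d 1 p + ξ ^ 2) ^ 2) *
        (if μ = μ' then 1 else 0) := by
  by_cases h : μ = μ'
  · subst h
    rw [if_pos rfl, mul_one]
    have hd : (d : ℝ) ≠ 0 := by exact_mod_cast (Fin.pos μ).ne'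
    have hsum : ∫ p in bzBox d 1, (∑ κ : Fin d, Real.sin (p κ) ^ 2) / (lapSymbol d 1 p + ξ ^ 2) ^ 2 =
        ∑ κ : Fin d, ∫ p in bzBox d 1, Real.sin (p κ) * Real.sin (p κ) / (lapSymbol d 1 p + ξ ^ 2) ^ 2 := by
      rw [← integral_finsetSum _ (fun κ _ => integrableOn_term hξ κ)]
      refine integral_congr_ae (Filter.Eventually.of_forall fun p => ?_)
      simp only [Finset.sum_div, sq]
    rw [hsum, Finset.sum_congr rfl fun κ _ => (integral328_diag_eq μ κ ξ).symm, Finset.sum_const, Finset.card_univ,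
      Fintype.card_fin, nsmul_eq_mul]
    field_simp
  · rw [if_neg h, mul_zero]
    exact integral328_offDiag h ξ

/-- **(3.28)** p. 441 [PDF 31], its SECOND equality in full — PROVED (ξ > 0): 2(2π)^{−d}∫_{|p|≤π/ξ} dp ξ^{−1} sin ξp_μ sin ξp_{μ′}/
(Δ^ξ(p)+1)² = (2/d)(2π)^{−d}∫_{|p′|≤π} dp′ (Σ_{μ=1}^d sin²p′_μ)/(Δ¹(p′)+ξ²)² ξ^{3−d}δ_{μμ′} (`eq328_rescale` + `integral328_symmetry`);
the FIRST equality (the lattice sum as the momentum integral, Plancherel on ξℤ^d) remains typed only (`Eq328`).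
[cite: Balaban1983Higgs3, (3.28) p.441] -/
theorem eq328_second (hξ : 0 < ξ) (μ μ' : Fin d) :
    2 * (2 * Real.pi)⁻¹ ^ d *
        ∫ p in bzBox d ξ, ξ⁻¹ * Real.sin (ξ * p μ) * Real.sin (ξ * p μ') / (lapSymbol d ξ p + 1) ^ 2 =
      2 / d * (2 * Real.pi)⁻¹ ^ d *
          (∫ p' in bzBox d 1, (∑ κ : Fin d, Real.sin (p' κ) ^ 2) / (lapSymbol d 1 p' + ξ ^ 2) ^ 2) *
        ξ ^ ((3 : ℤ) - d) * (if μ = μ' then 1 else 0) := by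
  rw [eq328_rescale hξ, integral328_symmetry hξ]
  ring

/-- kernel: hence (3.28) makes the lattice sums S(μ,μ′) diagonal, which is what the vanishing of (3.27) uses (T6).
[cite: Balaban1983Higgs3, (3.28) p.441] -/
theorem sum328_offDiag (h328 : Eq328 d ξ) {μ μ' : Fin d} (hne : μ ≠ μ') : sum328 d ξ μ μ' = 0 := by
  obtain ⟨h1, h2⟩ := h328 μ μ'
  rw [h1, h2, if_neg hne, mul_zero]

/-- p. 441: *"hence finally the term (3.27) is equal to 0"* — PROVED from (3.27) and (3.28) as typed (`Eq327`, `Eq328`).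
[cite: Balaban1983Higgs3, (3.28) p.441] -/
theorem lhs327_eq_zero_of_eq328 (τ : ℝ) (h327 : Eq327 d ξ τ) (h328 : Eq328 d ξ) (y : ZSite d) (μ μ' ν : Fin d) :
    lhs327 d ξ τ y μ μ' ν = 0 :=
  lhs327_eq_zero ξ τ h327 (fun _ _ hne => sum328_offDiag h328 hne) y μ μ' ν

end MomentumSymmetry

/-! ## v1.1 (cont.): the algebraic content of (3.27) — PROVED for every even, finitely supported kernel on ℤ^d -/

section Eq327Mechanism

variable {d : ℕ}

/-- The left side of (3.27) for an arbitrary kernel C on ξℤ^d (for C = C^ξ it is `lhs327`). [cite: Balaban1983Higgs3, (3.27) p.441] -/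
def lhs327Of (ξ τ : ℝ) (C : ZSite d → ℝ) (y : ZSite d) (μ μ' ν : Fin d) : ℝ :=
  τ * ∑' y' : ZSite d, ξ ^ d *
    (-(pdiffAdjZ ξ⁻¹ μ' C (y - y') * pdiffAdjZ ξ⁻¹ μ C (y' - y) * (ξ * ((y' ν : ℝ) - y ν))) +
      C (y - y') * pdiffZ ξ⁻¹ μ' (pdiffAdjZ ξ⁻¹ μ C) (y' - y) * (ξ * ((y' ν : ℝ) - y ν)))

/-- The lattice sum S(μ,μ′) of (3.28) for an arbitrary kernel C on ξℤ^d (for C = C^ξ it is `sum328`). [cite: Balaban1983Higgs3, (3.28) p.441] -/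
def sum328Of (ξ : ℝ) (C : ZSite d → ℝ) (μ μ' : Fin d) : ℝ :=
  ∑' y' : ZSite d, ξ ^ d * ((C (y' + unitVec μ) - C (y' - unitVec μ)) * pdiffZ ξ⁻¹ μ' C y')

/-- kernel: `lhs327` is `lhs327Of` at C = C^ξ. [cite: Balaban1983Higgs3, (3.27) p.441] -/
theorem lhs327_eq_of (ξ τ : ℝ) (y : ZSite d) (μ μ' ν : Fin d) :
    lhs327 d ξ τ y μ μ' ν = lhs327Of ξ τ (Cxi d ξ) y μ μ' ν := rfl

/-- kernel: `sum328` is `sum328Of` at C = C^ξ. [cite: Balaban1983Higgs3, (3.28) p.441] -/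
theorem sum328_eq_of (ξ : ℝ) (μ μ' : Fin d) : sum328 d ξ μ μ' = sum328Of ξ (Cxi d ξ) μ μ' := rfl

/-- kernel: (∂^{ξ*}_μf)(−y) = (∂^ξ_μf)(y) for an even kernel (companion of `pdiffZ_neg_of_even`). [cite: Balaban1983Higgs3, (3.27) p.441] -/
theorem pdiffAdjZ_neg_of_even (c : ℝ) (μ : Fin d) (f : ZSite d → ℝ) (hf : ∀ y, f (-y) = f y) (y : ZSite d) :
    pdiffAdjZ c μ f (-y) = pdiffZ c μ f y := by
  rw [← pdiffZ_neg_of_even c μ f hf (-y), neg_neg]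

/-- the pair sums P(v) = Σ_z C(z)C(z+v) of a kernel on ℤ^d. [folklore] -/
private def pairC (C : ZSite d → ℝ) (v : ZSite d) : ℝ := ∑' z : ZSite d, C z * C (z + v)

variable {C : ZSite d → ℝ}

/-- kernel: a product with a translate of a finitely supported kernel is finitely supported, hence summable. [folklore] -/
private theorem summable_mul_translate (hfin : (Function.support C).Finite) (g : ZSite d → ℝ) (u : ZSite d) :
    Summable (fun z : ZSite d => g z * C (z + u)) := by
  refine summable_of_hasFiniteSupport ?_
  have hpre : ((fun z : ZSite d => z + u) ⁻¹' Function.support C).Finite :=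
    hfin.preimage (add_left_injective u).injOn
  refine hpre.subset fun z hz => ?_
  simp only [Function.mem_support, ne_eq, mul_eq_zero, not_or] at hz
  exact hz.2

/-- kernel: translation invariance of the lattice sums, Σ_z F(z + u) = Σ_z F(z). [folklore] -/
private theorem tsum_translate (F : ZSite d → ℝ) (u : ZSite d) : ∑' z : ZSite d, F (z + u) = ∑' z : ZSite d, F z :=
  Equiv.tsum_eq (Equiv.addRight u) F

/-- kernel: P(−v) = P(v) (translation invariance). [folklore] -/
private theorem pairC_neg (v : ZSite d) : pairC C (-v) = pairC C v := by
  unfold pairC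
  rw [← tsum_translate (fun z => C z * C (z + -v)) v]
  refine tsum_congr fun z => ?_
  rw [show z + v + -v = z by abel]
  ring

/-- kernel: the first moment Σ_z z_ν C(z)C(z+v) = −½ v_ν P(v) for an even, finitely supported kernel (reflection z ↦ −z − v).
[folklore] -/
private theorem moment_eq (hC : ∀ z, C (-z) = C z) (hfin : (Function.support C).Finite) (v : ZSite d) (ν : Fin d) :
    ∑' z : ZSite d, (z ν : ℝ) * (C z * C (z + v)) = -(1 / 2) * (v ν : ℝ) * pairC C v := by
  set F : ZSite d → ℝ := fun z => (z ν : ℝ) * (C z * C (z + v)) with hF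
  have hrefl : ∑' z : ZSite d, F z = ∑' z : ZSite d, (-(v ν : ℝ) - z ν) * (C z * C (z + v)) := by
    rw [← Equiv.tsum_eq (Equiv.subLeft (-v)) F]
    refine tsum_congr fun z => ?_
    simp only [hF, Equiv.subLeft_apply]
    rw [show -v - z + v = -z by abel, hC z, show -v - z = -(z + v) by abel, hC (z + v)]
    simp only [Pi.neg_apply, Pi.add_apply, Int.cast_neg, Int.cast_add]
    ring
  have h1 : Summable F := by
    simpa only [hF, mul_assoc] using summable_mul_translate hfin (fun z => (z ν : ℝ) * C z) v
  have h2 : Summable (fun z : ZSite d => (v ν : ℝ) * (C z * C (z + v))) := by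
    simpa only [mul_assoc] using summable_mul_translate hfin (fun z => (v ν : ℝ) * C z) v
  have hsplit : ∑' z : ZSite d, (-(v ν : ℝ) - z ν) * (C z * C (z + v)) =
      -((v ν : ℝ) * pairC C v) - ∑' z : ZSite d, F z := by
    have : (fun z : ZSite d => (-(v ν : ℝ) - z ν) * (C z * C (z + v))) =
        fun z => -((v ν : ℝ) * (C z * C (z + v))) - F z := by
      funext z; simp only [hF]; ring
    rw [this, Summable.tsum_sub h2.neg h1, tsum_neg, pairC, ← tsum_mul_left]
  rw [hsplit] at hrefl
  linarith

/-- kernel: S(μ,μ′) of (3.28) in terms of pair sums: ξ^{d−1}[P(e_{μ′} − e_μ) − P(e_μ + e_{μ′})] (finitely supported kernel).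
[folklore] -/
private theorem sum328Of_eq_pairC (ξ : ℝ) (hfin : (Function.support C).Finite) (μ μ' : Fin d) :
    sum328Of ξ C μ μ' =
      ξ ^ d * ξ⁻¹ * (pairC C (unitVec μ' - unitVec μ) - pairC C (unitVec μ + unitVec μ')) := by
  have hA : ∑' z : ZSite d, C (z + unitVec μ) * C (z + unitVec μ') = pairC C (unitVec μ' - unitVec μ) := by
    rw [pairC, ← tsum_translate (fun z => C z * C (z + (unitVec μ' - unitVec μ))) (unitVec μ)]
    refine tsum_congr fun z => ?_
    rw [show z + unitVec μ + (unitVec μ' - unitVec μ) = z + unitVec μ' by abel]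
  have hB : ∑' z : ZSite d, C (z + unitVec μ) * C z = pairC C (unitVec μ) := by
    rw [pairC]; exact tsum_congr fun z => by ring
  have hD : ∑' z : ZSite d, C (z - unitVec μ) * C (z + unitVec μ') = pairC C (unitVec μ + unitVec μ') := by
    rw [pairC, ← tsum_translate (fun z => C z * C (z + (unitVec μ + unitVec μ'))) (-unitVec μ)]
    refine tsum_congr fun z => ?_
    rw [show z + -unitVec μ + (unitVec μ + unitVec μ') = z + unitVec μ' by abel, sub_eq_add_neg]
  have hE : ∑' z : ZSite d, C (z - unitVec μ) * C z = pairC C (unitVec μ) := by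
    rw [pairC, ← tsum_translate (fun z => C z * C (z + unitVec μ)) (-unitVec μ)]
    refine tsum_congr fun z => ?_
    rw [show z + -unitVec μ + unitVec μ = z by abel, sub_eq_add_neg]
  have sA : Summable (fun z : ZSite d => C (z + unitVec μ) * C (z + unitVec μ')) :=
    summable_mul_translate hfin _ _
  have sB : Summable (fun z : ZSite d => C (z + unitVec μ) * C z) := by
    simpa only [add_zero] using summable_mul_translate hfin (fun z => C (z + unitVec μ)) 0
  have sD : Summable (fun z : ZSite d => C (z - unitVec μ) * C (z + unitVec μ')) :=
    summable_mul_translate hfin _ _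
  have sE : Summable (fun z : ZSite d => C (z - unitVec μ) * C z) := by
    simpa only [add_zero] using summable_mul_translate hfin (fun z => C (z - unitVec μ)) 0
  have hexp : (fun y' : ZSite d => ξ ^ d * ((C (y' + unitVec μ) - C (y' - unitVec μ)) * pdiffZ ξ⁻¹ μ' C y')) =
      fun z => ξ ^ d * ξ⁻¹ * ((C (z + unitVec μ) * C (z + unitVec μ') - C (z + unitVec μ) * C z) -
        (C (z - unitVec μ) * C (z + unitVec μ') - C (z - unitVec μ) * C z)) := by
    funext z; simp only [pdiffZ]; ring
  rw [sum328Of, hexp, tsum_mul_left, Summable.tsum_sub (sA.sub sB) (sD.sub sE), Summable.tsum_sub sA sB,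
    Summable.tsum_sub sD sE, hA, hB, hD, hE]
  ring

/-- **(3.27)** p. 441 [PDF 31], its algebraic content — PROVED for every EVEN, FINITELY SUPPORTED kernel C on ξℤ^d (ξ ≠ 0):
the first member of (3.27) equals its last member, ½ tr q² S(μ,μ′)δ_{μν} − (μ↔μ′) with S from (3.28) (`lhs327Of`, `sum328Of`,
`rhs327`).  The printed case C = C^ξ (infinite support, exponentially decaying; `Eq327`) differs only in the convergence
bookkeeping (T5), which is not done here.  Route: translation y′ = z + y, the two identities C(−z) = C(z), (∂^{ξ*}C)(−z) =
(∂^ξC)(z), expansion into pair sums P(v) = Σ_zC(z)C(z+v) and the first-moment identity Σ_z z_νC(z)C(z+v) = −½v_νP(v)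
(reflection z ↦ −z−v). [cite: Balaban1983Higgs3, (3.27) p.441] -/
theorem eq327_of_even_finsupp (ξ τ : ℝ) (hξ : ξ ≠ 0) (C : ZSite d → ℝ) (hC : ∀ z, C (-z) = C z)
    (hfin : (Function.support C).Finite) (y : ZSite d) (μ μ' ν : Fin d) :
    lhs327Of ξ τ C y μ μ' ν = rhs327 τ (sum328Of ξ C) μ μ' ν := by
  -- Step A/B/C: translate y′ = z + y, use evenness, expand the difference quotients
  have hsummand : ∀ z : ZSite d,
      ξ ^ d * (-(pdiffAdjZ ξ⁻¹ μ' C (y - (z + y)) * pdiffAdjZ ξ⁻¹ μ C (z + y - y) * (ξ * (((z + y) ν : ℤ) - (y ν : ℝ)))) +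
        C (y - (z + y)) * pdiffZ ξ⁻¹ μ' (pdiffAdjZ ξ⁻¹ μ C) (z + y - y) * (ξ * (((z + y) ν : ℤ) - (y ν : ℝ)))) =
      ξ ^ d * ξ⁻¹ * ((z ν : ℝ) * (C z * C (z + (unitVec μ' - unitVec μ))) -
        (z ν : ℝ) * (C (z + unitVec μ') * C (z - unitVec μ))) := by
    intro z
    rw [show y - (z + y) = -z by abel, show z + y - y = z by abel, pdiffAdjZ_neg_of_even _ _ C hC, hC]
    simp only [pdiffZ, pdiffAdjZ, Pi.add_apply, Int.cast_add]
    rw [show z + unitVec μ' - unitVec μ = z + (unitVec μ' - unitVec μ) by abel]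
    field_simp
    ring
  have hL : lhs327Of ξ τ C y μ μ' ν =
      τ * (ξ ^ d * ξ⁻¹ * (∑' z : ZSite d, ((z ν : ℝ) * (C z * C (z + (unitVec μ' - unitVec μ))) -
        (z ν : ℝ) * (C (z + unitVec μ') * C (z - unitVec μ))))) := by
    rw [lhs327Of, ← tsum_translate _ y]
    simp_rw [hsummand]
    rw [tsum_mul_left]
  -- Step D: the second sum, shifted by e_μ, is a first moment plus a pair sum
  have s1 : Summable (fun z : ZSite d => (z ν : ℝ) * (C z * C (z + (unitVec μ' - unitVec μ)))) := by
    simpa only [mul_assoc] using summable_mul_translate hfin (fun z => (z ν : ℝ) * C z) (unitVec μ' - unitVec μ)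
  have s2 : Summable (fun z : ZSite d => (z ν : ℝ) * (C (z + unitVec μ') * C (z - unitVec μ))) := by
    have := summable_mul_translate hfin (fun z => (z ν : ℝ) * C (z + unitVec μ')) (-unitVec μ)
    simpa only [mul_assoc, ← sub_eq_add_neg] using this
  have s3 : Summable (fun z : ZSite d => (z ν : ℝ) * (C z * C (z + (unitVec μ + unitVec μ')))) := by
    simpa only [mul_assoc] using summable_mul_translate hfin (fun z => (z ν : ℝ) * C z) (unitVec μ + unitVec μ')
  have s4 : Summable (fun z : ZSite d => (if ν = μ then (1 : ℝ) else 0) * (C z * C (z + (unitVec μ + unitVec μ')))) := by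
    simpa only [mul_assoc] using
      summable_mul_translate hfin (fun z => (if ν = μ then (1 : ℝ) else 0) * C z) (unitVec μ + unitVec μ')
  have hshift : ∑' z : ZSite d, (z ν : ℝ) * (C (z + unitVec μ') * C (z - unitVec μ)) =
      ∑' z : ZSite d, ((z ν : ℝ) * (C z * C (z + (unitVec μ + unitVec μ'))) +
        (if ν = μ then (1 : ℝ) else 0) * (C z * C (z + (unitVec μ + unitVec μ')))) := by
    rw [← tsum_translate (fun z : ZSite d => (z ν : ℝ) * (C (z + unitVec μ') * C (z - unitVec μ))) (unitVec μ)]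
    refine tsum_congr fun z => ?_
    simp only [Pi.add_apply, unitVec, Pi.single_apply, Int.cast_add, Int.cast_ite, Int.cast_one, Int.cast_zero]
    rw [show z + Pi.single μ (1 : ℤ) + Pi.single μ' 1 = z + (Pi.single μ 1 + Pi.single μ' 1) by abel,
      show z + Pi.single μ (1 : ℤ) - Pi.single μ 1 = z by abel]
    ring
  have hM1 := moment_eq hC hfin (unitVec μ' - unitVec μ) ν
  have hM2 := moment_eq hC hfin (unitVec μ + unitVec μ') ν
  have hδ : ∑' z : ZSite d, (if ν = μ then (1 : ℝ) else 0) * (C z * C (z + (unitVec μ + unitVec μ'))) =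
      (if ν = μ then (1 : ℝ) else 0) * pairC C (unitVec μ + unitVec μ') := by
    rw [pairC, ← tsum_mul_left]
  rw [hL, Summable.tsum_sub s1 s2, hshift, Summable.tsum_add s3 s4, hM1, hM2, hδ, rhs327,
    sum328Of_eq_pairC ξ hfin μ μ', sum328Of_eq_pairC ξ hfin μ' μ,
    show unitVec μ - unitVec μ' = -(unitVec μ' - unitVec μ) by abel, pairC_neg, add_comm (unitVec μ') (unitVec μ)]
  simp only [unitVec, Pi.sub_apply, Pi.add_apply, Pi.single_apply, Int.cast_sub, Int.cast_add, Int.cast_ite,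
    Int.cast_one, Int.cast_zero]
  rcases eq_or_ne ν μ with h1 | h1 <;> rcases eq_or_ne ν μ' with h2 | h2
  · subst h1; subst h2
    simp only [if_true]
    ring
  · subst h1
    simp only [if_true, h2, Ne.symm h2, if_false]
    ring
  · subst h2
    simp only [if_true, h1, Ne.symm h1, if_false]
    ring
  · simp only [h1, h2, Ne.symm h1, Ne.symm h2, if_false]
    ring

/-- kernel: in particular (3.27)'s printed identity holds verbatim for any even finitely supported kernel in place of C^ξ,
and its last member vanishes whenever S is diagonal (`rhs327_eq_zero_of_diag`). [cite: Balaban1983Higgs3, (3.27) p.441] -/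
theorem lhs327Of_eq_zero_of_diag (ξ τ : ℝ) (hξ : ξ ≠ 0) (C : ZSite d → ℝ) (hC : ∀ z, C (-z) = C z)
    (hfin : (Function.support C).Finite) (hdiag : ∀ μ μ' : Fin d, μ ≠ μ' → sum328Of ξ C μ μ' = 0)
    (y : ZSite d) (μ μ' ν : Fin d) : lhs327Of ξ τ C y μ μ' ν = 0 := by
  rw [eq327_of_even_finsupp ξ τ hξ C hC hfin]
  exact rhs327_eq_zero_of_diag τ _ hdiag μ μ' ν

end Eq327Mechanism

end

end Literature.MathematicalPhysics.QuantumFieldTheory.Balaban1983to89.B3Sect3VectorSelfEnergy
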